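import Literature.Analysis.UnboundedOperators.HeatFlowCalculus
import Mathlib.Analysis.Real.Pi.Bounds
import Mathlib.MeasureTheory.Function.SpecialFunctions.Inner
import HarnessLib

/-!
# The Oseen–heat operator `e^{τΔ} P ∇·` in physical space: kernel bounds in dimension three

Analysis/FluidPDE support file (layer 3 of the physical-space proof of Tao 2011, Prop. 9.1,
bounded total speed, `TaoBoundedTotalSpeedMild.lean`). The nonlinear Duhamel term of the
Navier–Stokes equations is `∫₀ᵗ e^{(t-s)Δ} P ∇·(u ⊗ u)(s) ds` (Tao 2011, (45); Lemarié-Rieusset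
2016, §6.2, the Oseen tensor). Instead of the Fourier multiplier `P = 1 + ∇(-Δ)⁻¹∇·` we realise
`𝒩_τ = e^{τΔ} P ∇·` on a matrix field `F = (Fⱼₖ)` of scalar functions directly through the heat
flow, using `(-Δ)⁻¹ e^{τΔ} = ∫₀^∞ e^{(τ+σ)Δ} dσ`:

  `(𝒩_τ F)ᵢ = ∑ⱼ ∂ⱼ e^{τΔ} Fⱼᵢ + ∑ⱼₖ ∫₀^∞ ∂ᵢ∂ⱼ∂ₖ e^{(τ+σ)Δ} Fⱼₖ dσ`   (`oseenHeat τ F i`),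

a Bochner integral in `σ`, pointwise in `x`. All statements are **proved**; the pairing identities
showing that this is the right operator (it reproduces the tested Duhamel formula against
divergence-free test fields and is weakly divergence free) are in `OseenHeatPairing.lean`.

* `section IteratedDeriv` (any dimension, `φ ∈ Lᵖ`): the iterated directional derivatives of the
  heat flow `heatD1 s v φ = ∂ᵥe^{sΔ}φ`, `heatD2`, `heatD3 s u v w φ = ∂ᵤ∂ᵥ∂_w e^{sΔ}φ`, their
  Lebesgue classes and the time-splitting `∂ᵤ∂ᵥ∂_w e^{(a+c+d)Δ}φ = ∂ᵤe^{aΔ} ∂ᵥe^{cΔ} ∂_w e^{dΔ} φ`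
  (`heatD3_eq_heatD1_heatD1_heatD1`: semigroup law and "derivatives fall on the data").
* `section KernelDim3`, `section DerivBoundsDim3` (`dim E = 3`, `‖v‖ ≤ 1`): the kernel norms
  `‖∂ᵥG_a‖₁ ≤ 3a^{-1/2}`, `‖∂ᵥG_a‖_∞ ≤ a⁻²`, `‖∂ᵥG_a‖₂ ≤ 2a^{-5/4}` (numerical constants from
  `2^{3/2} ≤ 3`, `(4π)^{-3/2} ≤ 1`), hence `‖∂ᵥe^{aΔ}φ‖_p ≤ 3a^{-1/2}‖φ‖_p`,
  `‖∂³e^{sΔ}φ‖_p ≤ 216 s^{-3/2}‖φ‖_p` and the pointwise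
  `|∂³e^{sΔ}φ(x)| ≤ 27 s⁻¹ ‖∂G_{s/3}‖_{p'} ‖φ‖_p` (Young three times at the clock `s/3`).
* `section IteratedContinuity`: joint continuity of `(s, x) ↦ ∂³e^{sΔ}φ(x)` on `(0,∞) × E` for
  `φ ∈ L¹` (`continuousOn_uncurry_heatD3`, an inductive dominated-convergence step
  `continuousOn_heatD1_param` over the layers), whence measurability of the `σ`-integrand.
* `section Oseen` (`dim E = 3`): the three pointwise bounds used for the bilinear estimate,
  `|(𝒩_τF)ᵢ(x)| ≤ 123 τ⁻² ∑‖Fⱼₖ‖₁`, `≤ 175 τ^{-5/4} ∑‖Fⱼₖ‖₂`, `≤ 327 τ^{-1/2} ∑‖Fⱼₖ‖_∞`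
  (`enorm_oseenHeat_le_of_one/two/top`; the `σ`-integral converges because the third
  derivative gains `(τ+σ)^{-3/2}`), i.e. the kernel of `e^{τΔ}P∇·` obeys the same scaling bounds as
  `∇G_τ` (Lemarié-Rieusset 2016, §6.2, the Oseen kernel `O(τ^{-2}(1 + |x|/√τ)^{-4})`; only
  these three integrated instances are used).
* `section L1Bound`: `‖(𝒩_τF)ᵢ‖₁ ≤ 435 τ^{-1/2} ∑‖Fⱼₖ‖₁` (`lintegral_enorm_oseenHeat_le_of_one`,
  Minkowski's integral inequality in `lintegral` form / Tonelli).
* `section ParamMeasurability`: `AEStronglyMeasurable` in `(parameter, x)` of `e^{c(p)Δ}g(p,·)`,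
  of `heatD1/2/3` and of `oseenHeat` for jointly measurable data `g : P × E → ℝ` and measurable
  clocks `c > 0` (`aestronglyMeasurable_oseenHeat_param`), needed to integrate the Duhamel
  integrand in `(s, x)`; the projections `quasiMeasurePreserving_proj₁₃/₂₃`.

## Mathlib / tree search

Tree: `heatExtension`, `heatExtension_add_holds`, `lintegral_enorm_fderiv_heatKernel_le`,
`norm_fderiv_heatKernel_le` (`HeatKernelGradient`), `eLpNorm_heatExtension_le_rpow_holds`, the
layer `HeatFlowCalculus`. The tree's Leray projector (`FluidPDE/LerayProjector`) and Oseen-type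
objects (`heatDivTensor` in `MildSolution.lean`, `∫ (DK_τ)(x-y)[v y] • w y dy`, no projection) do
not provide `e^{τΔ}P∇·` with pointwise kernel bounds (`lean search 'oseen|Oseen|heatDivTensor|
lerayProj' --decl`). Mathlib: `MeasureTheory.eLpNorm_convolution_le…` (Young, via the tree's
wrappers), `MeasureTheory.AEStronglyMeasurable.integral_prod_right'`,
`Measurable.inner`, `Real.pi_gt_three`.

## References

* T. Tao, *Localisation and compactness properties of the Navier–Stokes global regularity
  problem*, Anal. PDE 6 (2013) = arXiv:1108.1165, §9, (45) and the proof of Prop. 9.1.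
  Bib key `Tao2011`.
* P. G. Lemarié-Rieusset, *The Navier–Stokes Problem in the 21st Century*, CRC 2016, §6.2
  (heat kernel and Oseen tensor). Bib key `LemarieRieusset2016`.
* M.-H. Giga, Y. Giga, J. Saal, *Nonlinear Partial Differential Equations*, Birkhäuser 2010,
  §1.1.3 (derivative estimates for `e^{tΔ}`). Bib key `GigaGigaSaal2010`.
-/

open MeasureTheory Filter Topology Set InnerProductSpace Metric
open scoped Real ENNReal NNReal Convolution Laplacian RealInnerProductSpace

noncomputable section

namespace Literature.Analysis.FluidPDE

/-! ## Iterated derivatives of the heat flow: `D¹`, `D²`, `D³` -/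

section IteratedDeriv

variable {E : Type*} [NormedAddCommGroup E] [InnerProductSpace ℝ E] [FiniteDimensional ℝ E]
  [MeasurableSpace E] [BorelSpace E]

/-- `heatD1 s v φ = ∂ᵥ e^{sΔ} φ`. [folklore] -/
def heatD1 (s : ℝ) (v : E) (φ : E → ℝ) (x : E) : ℝ :=
  fderiv ℝ (UnboundedOperators.heatExtension φ s) x v

/-- `heatD2 s v w φ = ∂ᵥ ∂_w e^{sΔ} φ`. [folklore] -/
def heatD2 (s : ℝ) (v w : E) (φ : E → ℝ) (x : E) : ℝ :=
  fderiv ℝ (fun y => fderiv ℝ (UnboundedOperators.heatExtension φ s) y w) x v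

/-- `heatD3 s u v w φ = ∂ᵤ ∂ᵥ ∂_w e^{sΔ} φ`. [folklore] -/
def heatD3 (s : ℝ) (u v w : E) (φ : E → ℝ) (x : E) : ℝ :=
  fderiv ℝ (fun z => fderiv ℝ (fun y => fderiv ℝ (UnboundedOperators.heatExtension φ s) y w) z v) x u

variable {φ : E → ℝ} {p : ℝ≥0∞}

/-- `heatD1 s v φ` is smooth, in `Lᵖ` when `φ ∈ Lᵖ`, and is the convolution `(∂ᵥ G_s) ⋆ φ`.
[folklore] -/
theorem heatD1_eq_convolution (hφ : MemLp φ p volume) (hp : 1 ≤ p) {s : ℝ} (hs : 0 < s) (v : E) :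
    heatD1 s v φ = ((fun z => fderiv ℝ (UnboundedOperators.heatKernel s) z v) ⋆[ContinuousLinearMap.lsmul ℝ ℝ, volume] φ) :=
  UnboundedOperators.fderiv_heatExtension_apply_eq_convolution' hφ hp hs v

/-- `heatD1 s v φ ∈ Lᵖ` for `φ ∈ Lᵖ`. [folklore] -/
theorem memLp_heatD1 (hφ : MemLp φ p volume) (hp : 1 ≤ p) {s : ℝ} (hs : 0 < s) (v : E) :
    MemLp (heatD1 s v φ) p volume :=
  UnboundedOperators.memLp_fderiv_heatExtension_apply hφ hp hs v

/-- `heatD1 s v φ` is `C^∞`. [folklore] -/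
theorem contDiff_heatD1 (hφ : MemLp φ p volume) (hp : 1 ≤ p) {s : ℝ} (hs : 0 < s) (v : E)
    {n : ℕ∞} : ContDiff ℝ n (heatD1 s v φ) :=
  UnboundedOperators.contDiff_fderiv_heatExtension_apply hφ hp hs v

/-- **Splitting the heat time between two derivatives**: `∂ᵥ∂_w e^{(a+c)Δ} φ = ∂ᵥ e^{aΔ} (∂_w e^{cΔ} φ)`
for `a, c > 0` (semigroup law, derivatives fall on smooth `Lᵖ` data). [folklore] -/
theorem heatD2_eq_heatD1_heatD1 (hφ : MemLp φ p volume) (hp : 1 ≤ p) {a c : ℝ} (ha : 0 < a)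
    (hc : 0 < c) (v w : E) :
    heatD2 (a + c) v w φ = heatD1 a v (heatD1 c w φ) := by
  funext x
  unfold heatD2 heatD1
  have hsemi : UnboundedOperators.heatExtension φ (a + c) = UnboundedOperators.heatExtension (UnboundedOperators.heatExtension φ c) a := by
    rw [UnboundedOperators.heatExtension_add_holds hφ hp hc ha, add_comm]
  have hψ : (fun y => fderiv ℝ (UnboundedOperators.heatExtension φ (a + c)) y w) =
      UnboundedOperators.heatExtension (fun y => fderiv ℝ (UnboundedOperators.heatExtension φ c) y w) a := by
    funext y
    rw [hsemi]
    exact UnboundedOperators.fderiv_heatExtension_apply_eq_heatExtension_fderiv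
      ((UnboundedOperators.contDiff_heatExtension_holds hφ hp hc).of_le (by exact_mod_cast le_top))
      (UnboundedOperators.memLp_heatExtension_holds hφ hp hc) hp (UnboundedOperators.memLp_fderiv_heatExtension_apply hφ hp hc w) hp ha y
  rw [hψ]

/-- **Splitting the heat time between three derivatives**:
`∂ᵤ∂ᵥ∂_w e^{(a+c+d)Δ} φ = ∂ᵤ e^{aΔ} (∂ᵥ e^{cΔ} (∂_w e^{dΔ} φ))` for `a, c, d > 0`. [folklore] -/
theorem heatD3_eq_heatD1_heatD1_heatD1 (hφ : MemLp φ p volume) (hp : 1 ≤ p) {a c d : ℝ}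
    (ha : 0 < a) (hc : 0 < c) (hd : 0 < d) (u v w : E) :
    heatD3 (a + c + d) u v w φ = heatD1 a u (heatD1 c v (heatD1 d w φ)) := by
  -- first split off `d`: `∂ᵥ∂_w e^{((a+c)+d)Δ} φ = ∂ᵥ e^{(a+c)Δ} ψ`, `ψ = ∂_w e^{dΔ} φ`
  set ψ : E → ℝ := heatD1 d w φ with hψ
  have hψp : MemLp ψ p volume := memLp_heatD1 hφ hp hd w
  have h2 : ∀ z, heatD2 (a + c + d) v w φ z = heatD1 (a + c) v ψ z := fun z => by
    rw [heatD2_eq_heatD1_heatD1 hφ hp (by positivity : 0 < a + c) hd v w]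
  -- `heatD3` is the `u`-derivative of `z ↦ heatD2 … z`
  funext x
  have hD3 : heatD3 (a + c + d) u v w φ x =
      fderiv ℝ (fun z => heatD2 (a + c + d) v w φ z) x u := rfl
  rw [hD3]
  simp_rw [h2]
  change heatD2 (a + c) u v ψ x = _
  rw [heatD2_eq_heatD1_heatD1 hψp hp ha hc u v]

/-- `heatD3 s u v w φ ∈ L^q` whenever `φ ∈ Lᵖ` and the innermost layer lands in `L^q`:
here the basic instance `q = p`. [folklore] -/
theorem memLp_heatD3 (hφ : MemLp φ p volume) (hp : 1 ≤ p) {s : ℝ} (hs : 0 < s) (u v w : E) :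
    MemLp (heatD3 s u v w φ) p volume := by
  have h3 : 0 < s / 3 := by positivity
  have : s = s / 3 + s / 3 + s / 3 := by ring
  rw [this, heatD3_eq_heatD1_heatD1_heatD1 hφ hp h3 h3 h3]
  exact memLp_heatD1 (memLp_heatD1 (memLp_heatD1 hφ hp h3 w) hp h3 v) hp h3 u

end IteratedDeriv

/-! ## Kernel norms in dimension three -/

section KernelDim3

variable {E : Type*} [NormedAddCommGroup E] [InnerProductSpace ℝ E] [FiniteDimensional ℝ E]
  [MeasurableSpace E] [BorelSpace E]

/-- `2^{3/2} ≤ 3`. [folklore] -/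
theorem two_rpow_three_halves_le_three : (2 : ℝ) ^ (3 / 2 : ℝ) ≤ 3 := by
  have h : ((2 : ℝ) ^ (3 / 2 : ℝ)) ^ 2 ≤ 3 ^ 2 := by
    rw [← Real.rpow_natCast, ← Real.rpow_mul (by norm_num)]
    norm_num
  exact (pow_le_pow_iff_left₀ (by positivity) (by norm_num) two_ne_zero).1 h

/-- `‖∂ᵥ G_a‖_{L¹} ≤ 3 a^{-1/2}` in dimension three, for `‖v‖ ≤ 1`. [folklore] -/
theorem lintegral_enorm_fderiv_heatKernel_apply_le_dim3 (hE : Module.finrank ℝ E = 3) {a : ℝ}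
    (ha : 0 < a) {v : E} (hv : ‖v‖ ≤ 1) :
    ∫⁻ z, ‖fderiv ℝ (UnboundedOperators.heatKernel (E := E) a) z v‖ₑ ≤ ENNReal.ofReal (3 * a ^ (-(1 / 2) : ℝ)) := by
  refine (UnboundedOperators.lintegral_enorm_fderiv_heatKernel_apply_le ha v).trans (ENNReal.ofReal_le_ofReal ?_)
  rw [hE, show ((3 : ℕ) : ℝ) / 2 = (3 / 2 : ℝ) by norm_num]
  have h2 := two_rpow_three_halves_le_three
  have h0 : 0 ≤ a ^ (-(1 / 2) : ℝ) := Real.rpow_nonneg ha.le _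
  calc (2 : ℝ) ^ (3 / 2 : ℝ) * a ^ (-(1 / 2) : ℝ) * ‖v‖ ≤ 3 * a ^ (-(1 / 2) : ℝ) * 1 := by
        gcongr
    _ = 3 * a ^ (-(1 / 2) : ℝ) := mul_one _

/-- `‖∂ᵥ G_a‖_{L^∞} ≤ a^{-2}` in dimension three, for `‖v‖ ≤ 1` (`(4π)^{-3/2} ≤ 1`). [folklore] -/
theorem eLpNorm_top_fderiv_heatKernel_apply_le_dim3 (hE : Module.finrank ℝ E = 3) {a : ℝ}
    (ha : 0 < a) {v : E} (hv : ‖v‖ ≤ 1) :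
    eLpNorm (fun z => fderiv ℝ (UnboundedOperators.heatKernel (E := E) a) z v) ∞ volume ≤
      ENNReal.ofReal (a ^ (-2 : ℝ)) := by
  refine (UnboundedOperators.eLpNorm_top_fderiv_heatKernel_apply_le ha v).trans (ENNReal.ofReal_le_ofReal ?_)
  rw [hE]
  have h1 : (4 * π * a) ^ (-((3 : ℕ) : ℝ) / 2) ≤ a ^ (-(3 / 2) : ℝ) := by
    rw [show (-((3 : ℕ) : ℝ) / 2 : ℝ) = -(3 / 2) by norm_num,
      Real.mul_rpow (by positivity) ha.le]
    refine mul_le_of_le_one_left (Real.rpow_nonneg ha.le _) ?_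
    refine Real.rpow_le_one_of_one_le_of_nonpos ?_ (by norm_num)
    have := Real.pi_gt_three
    linarith
  have h2 : (Real.sqrt a)⁻¹ = a ^ (-(1 / 2) : ℝ) := by
    rw [Real.sqrt_eq_rpow, ← Real.rpow_neg ha.le]
  have h3 : a ^ (-(3 / 2) : ℝ) * a ^ (-(1 / 2) : ℝ) = a ^ (-2 : ℝ) := by
    rw [← Real.rpow_add ha]; norm_num
  calc (4 * π * a) ^ (-((3 : ℕ) : ℝ) / 2) * (Real.sqrt a)⁻¹ * ‖v‖
      ≤ a ^ (-(3 / 2) : ℝ) * a ^ (-(1 / 2) : ℝ) * 1 := by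
        rw [h2]
        gcongr
    _ = a ^ (-2 : ℝ) := by rw [mul_one, h3]

/-- `‖∂ᵥ G_a‖_{L²} ≤ 2 a^{-5/4}` in dimension three, for `‖v‖ ≤ 1` (interpolation between `L¹`
and `L^∞`). [folklore] -/
theorem eLpNorm_two_fderiv_heatKernel_apply_le_dim3 (hE : Module.finrank ℝ E = 3) {a : ℝ}
    (ha : 0 < a) {v : E} (hv : ‖v‖ ≤ 1) :
    eLpNorm (fun z => fderiv ℝ (UnboundedOperators.heatKernel (E := E) a) z v) 2 volume ≤
      ENNReal.ofReal (2 * a ^ (-(5 / 4) : ℝ)) := by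
  have hK : AEStronglyMeasurable (fun z => fderiv ℝ (UnboundedOperators.heatKernel (E := E) a) z v) volume :=
    (UnboundedOperators.continuous_fderiv_heatKernel_apply a v).aestronglyMeasurable
  have h := UnboundedOperators.eLpNorm_le_eLpNorm_rpow_mul_eLpNorm_top_rpow hK one_ne_zero (one_le_two : (1 : ℝ≥0∞) ≤ 2)
  have hexp : (1 : ℝ≥0∞).toReal / (2 : ℝ≥0∞).toReal = (1 / 2 : ℝ) := by norm_num
  rw [hexp, show (1 : ℝ) - 1 / 2 = 1 / 2 by norm_num, eLpNorm_one_eq_lintegral_enorm] at h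
  refine h.trans ?_
  calc (∫⁻ z, ‖fderiv ℝ (UnboundedOperators.heatKernel a) z v‖ₑ) ^ (1 / 2 : ℝ) *
        eLpNorm (fun z => fderiv ℝ (UnboundedOperators.heatKernel a) z v) ∞ volume ^ (1 / 2 : ℝ)
      ≤ ENNReal.ofReal (3 * a ^ (-(1 / 2) : ℝ)) ^ (1 / 2 : ℝ) *
          ENNReal.ofReal (a ^ (-2 : ℝ)) ^ (1 / 2 : ℝ) := by
        gcongr
        · exact lintegral_enorm_fderiv_heatKernel_apply_le_dim3 hE ha hv
        · exact eLpNorm_top_fderiv_heatKernel_apply_le_dim3 hE ha hv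
    _ = ENNReal.ofReal ((3 * a ^ (-(1 / 2) : ℝ) * a ^ (-2 : ℝ)) ^ (1 / 2 : ℝ)) := by
        rw [← ENNReal.mul_rpow_of_nonneg _ _ (by norm_num), ← ENNReal.ofReal_mul (by positivity),
          ENNReal.ofReal_rpow_of_nonneg (by positivity) (by norm_num)]
    _ ≤ ENNReal.ofReal (2 * a ^ (-(5 / 4) : ℝ)) := by
        refine ENNReal.ofReal_le_ofReal ?_
        rw [mul_assoc, ← Real.rpow_add ha, show (-(1 / 2) : ℝ) + -2 = -(5 / 2) by norm_num,
          Real.mul_rpow (by norm_num) (Real.rpow_nonneg ha.le _), ← Real.rpow_mul ha.le,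
          show (-(5 / 2) * (1 / 2) : ℝ) = -(5 / 4) by norm_num]
        refine mul_le_mul_of_nonneg_right ?_ (Real.rpow_nonneg ha.le _)
        have : ((3 : ℝ) ^ (1 / 2 : ℝ)) ^ 2 ≤ 2 ^ 2 := by
          rw [← Real.rpow_natCast, ← Real.rpow_mul (by norm_num)]; norm_num
        exact (pow_le_pow_iff_left₀ (by positivity) (by norm_num) two_ne_zero).1 this

end KernelDim3

/-! ## Bounds for `D¹` and `D³` in dimension three -/

section DerivBoundsDim3

variable {E : Type*} [NormedAddCommGroup E] [InnerProductSpace ℝ E] [FiniteDimensional ℝ E]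
  [MeasurableSpace E] [BorelSpace E]

variable {φ : E → ℝ} {p : ℝ≥0∞}

/-- Pointwise Hölder bound for `D¹`: `|∂ᵥ e^{aΔ} φ (x)| ≤ ‖∂ᵥ G_a‖_q ‖φ‖_p`. [folklore] -/
theorem enorm_heatD1_le (hφ : MemLp φ p volume) (hp : 1 ≤ p) {a : ℝ} (ha : 0 < a) (v x : E)
    (q : ℝ≥0∞) [q.HolderConjugate p] :
    ‖heatD1 a v φ x‖ₑ ≤ eLpNorm (fun z => fderiv ℝ (UnboundedOperators.heatKernel (E := E) a) z v) q volume *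
      eLpNorm φ p volume :=
  UnboundedOperators.enorm_fderiv_heatExtension_apply_le hφ hp ha x v q

/-- `L^∞` membership of `D¹` of an `Lᵖ` function (from the pointwise Hölder bound). [folklore] -/
theorem memLp_top_heatD1 (hφ : MemLp φ p volume) (hp : 1 ≤ p) {a : ℝ} (ha : 0 < a) (v : E) :
    MemLp (heatD1 a v φ) ∞ volume := by
  haveI : p.conjExponent.HolderConjugate p :=
    (ENNReal.HolderConjugate.conjExponent hp).symm
  refine ⟨(contDiff_heatD1 hφ hp ha v (n := 0)).continuous.aestronglyMeasurable, ?_⟩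
  rw [eLpNorm_exponent_top]
  refine lt_of_le_of_lt (eLpNormEssSup_le_of_ae_enorm_bound (Eventually.of_forall fun x =>
    enorm_heatD1_le hφ hp ha v x p.conjExponent)) ?_
  exact ENNReal.mul_lt_top (UnboundedOperators.memLp_fderiv_heatKernel_apply ha v _).eLpNorm_lt_top hφ.eLpNorm_lt_top

/-- Young bound for `D¹` in dimension three: `‖∂ᵥ e^{aΔ} φ‖_r ≤ 3 a^{-1/2} ‖φ‖_r`, `‖v‖ ≤ 1`.
[folklore] -/
theorem eLpNorm_heatD1_le_dim3 (hE : Module.finrank ℝ E = 3) (hφ : MemLp φ p volume) (hp : 1 ≤ p)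
    {a : ℝ} (ha : 0 < a) {v : E} (hv : ‖v‖ ≤ 1) :
    eLpNorm (heatD1 a v φ) p volume ≤ ENNReal.ofReal (3 * a ^ (-(1 / 2) : ℝ)) * eLpNorm φ p volume := by
  unfold heatD1
  rw [UnboundedOperators.fderiv_heatExtension_apply_eq_convolution' hφ hp ha v]
  exact (UnboundedOperators.eLpNorm_convolution_le_lintegral_enorm_mul
    (UnboundedOperators.continuous_fderiv_heatKernel_apply a v).aestronglyMeasurable hφ.1 hp).trans
    (mul_le_mul_left (lintegral_enorm_fderiv_heatKernel_apply_le_dim3 hE ha hv) _)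

/-- `(s/3)^{-e} = 3^e s^{-e}` for `s > 0`. [folklore] -/
theorem div_three_rpow_neg {s : ℝ} (hs : 0 < s) (e : ℝ) :
    (s / 3) ^ (-e) = (3 : ℝ) ^ e * s ^ (-e) := by
  rw [Real.div_rpow hs.le (by norm_num), Real.rpow_neg (by norm_num : (0 : ℝ) ≤ 3), div_eq_mul_inv,
    inv_inv, mul_comm]

/-- `√3 ≤ 2` and `3^{5/4} ≤ 4` (numerical constants). [folklore] -/
theorem three_rpow_bounds : (3 : ℝ) ^ (1 / 2 : ℝ) ≤ 2 ∧ (3 : ℝ) ^ (5 / 4 : ℝ) ≤ 4 := by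
  constructor
  · have : ((3 : ℝ) ^ (1 / 2 : ℝ)) ^ 2 ≤ 2 ^ 2 := by
      rw [← Real.rpow_natCast, ← Real.rpow_mul (by norm_num)]; norm_num
    exact (pow_le_pow_iff_left₀ (by positivity) (by norm_num) two_ne_zero).1 this
  · have : ((3 : ℝ) ^ (5 / 4 : ℝ)) ^ 4 ≤ 4 ^ 4 := by
      rw [← Real.rpow_natCast, ← Real.rpow_mul (by norm_num)]; norm_num
    exact (pow_le_pow_iff_left₀ (by positivity) (by norm_num) (by norm_num)).1 this

/-- **Three-layer bound for `D³` in dimension three.** For `φ ∈ Lᵖ`, unit vectors `u v w`,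
`s > 0` and conjugate `q`:
`|∂ᵤ∂ᵥ∂_w e^{sΔ} φ (x)| ≤ 27 s⁻¹ ‖∂_w G_{s/3}‖_q ‖φ‖_p`
(`∂ᵤ e^{(s/3)Δ} ∘ ∂ᵥ e^{(s/3)Δ}` costs `(3 (s/3)^{-1/2})² = 27 s⁻¹` in `L^∞ → L^∞`). [folklore] -/
theorem enorm_heatD3_le_dim3 (hE : Module.finrank ℝ E = 3) (hφ : MemLp φ p volume) (hp : 1 ≤ p)
    {s : ℝ} (hs : 0 < s) {u v w : E} (hu : ‖u‖ ≤ 1) (hv : ‖v‖ ≤ 1) (x : E) (q : ℝ≥0∞)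
    [q.HolderConjugate p] :
    ‖heatD3 s u v w φ x‖ₑ ≤ ENNReal.ofReal (27 * s⁻¹) *
      (eLpNorm (fun z => fderiv ℝ (UnboundedOperators.heatKernel (E := E) (s / 3)) z w) q volume *
        eLpNorm φ p volume) := by
  have h3 : 0 < s / 3 := by positivity
  have hsplit : s = s / 3 + s / 3 + s / 3 := by ring
  set ψ₁ : E → ℝ := heatD1 (s / 3) w φ with hψ₁
  set ψ₂ : E → ℝ := heatD1 (s / 3) v ψ₁ with hψ₂
  have hψ₁ : MemLp ψ₁ ∞ volume := memLp_top_heatD1 hφ hp h3 w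
  have hψ₂ : MemLp ψ₂ ∞ volume := memLp_heatD1 hψ₁ le_top h3 v
  -- the three layers
  have hb₁ : eLpNorm ψ₁ ∞ volume ≤ eLpNorm (fun z => fderiv ℝ (UnboundedOperators.heatKernel (E := E) (s / 3)) z w) q
      volume * eLpNorm φ p volume := by
    rw [eLpNorm_exponent_top]
    exact eLpNormEssSup_le_of_ae_enorm_bound (Eventually.of_forall fun y =>
      enorm_heatD1_le hφ hp h3 w y q)
  have hb₂ : eLpNorm ψ₂ ∞ volume ≤ ENNReal.ofReal (3 * (s / 3) ^ (-(1 / 2) : ℝ)) * eLpNorm ψ₁ ∞ volume :=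
    eLpNorm_heatD1_le_dim3 hE hψ₁ le_top h3 hv
  have hb₃ : ‖heatD1 (s / 3) u ψ₂ x‖ₑ ≤ ENNReal.ofReal (3 * (s / 3) ^ (-(1 / 2) : ℝ)) *
      eLpNorm ψ₂ ∞ volume := by
    refine (enorm_heatD1_le hψ₂ le_top h3 u x 1).trans (mul_le_mul_left ?_ _)
    rw [eLpNorm_one_eq_lintegral_enorm]
    exact lintegral_enorm_fderiv_heatKernel_apply_le_dim3 hE h3 hu
  have hconst : ENNReal.ofReal (3 * (s / 3) ^ (-(1 / 2) : ℝ)) *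
      ENNReal.ofReal (3 * (s / 3) ^ (-(1 / 2) : ℝ)) ≤ ENNReal.ofReal (27 * s⁻¹) := by
    rw [← ENNReal.ofReal_mul (by positivity)]
    refine ENNReal.ofReal_le_ofReal (le_of_eq ?_)
    rw [div_three_rpow_neg hs]
    have h1 : (3 : ℝ) ^ (1 / 2 : ℝ) * (3 : ℝ) ^ (1 / 2 : ℝ) = 3 := by
      rw [← Real.rpow_add (by norm_num)]; norm_num
    have h2 : s ^ (-(1 / 2) : ℝ) * s ^ (-(1 / 2) : ℝ) = s⁻¹ := by
      rw [← Real.rpow_add hs, ← Real.rpow_neg_one]; norm_num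
    calc 3 * ((3 : ℝ) ^ (1 / 2 : ℝ) * s ^ (-(1 / 2) : ℝ)) * (3 * ((3 : ℝ) ^ (1 / 2 : ℝ) * s ^ (-(1 / 2) : ℝ)))
        = 9 * ((3 : ℝ) ^ (1 / 2 : ℝ) * (3 : ℝ) ^ (1 / 2 : ℝ)) * (s ^ (-(1 / 2) : ℝ) * s ^ (-(1 / 2) : ℝ)) := by
          ring
      _ = 27 * s⁻¹ := by rw [h1, h2]; ring
  have hs3 : s / 3 + s / 3 + s / 3 = s := hsplit.symm
  have hD3 : heatD3 s u v w φ = heatD1 (s / 3) u ψ₂ := by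
    have := heatD3_eq_heatD1_heatD1_heatD1 hφ hp h3 h3 h3 u v w
    rwa [hs3] at this
  rw [hD3]
  calc ‖heatD1 (s / 3) u ψ₂ x‖ₑ
      ≤ ENNReal.ofReal (3 * (s / 3) ^ (-(1 / 2) : ℝ)) * (ENNReal.ofReal (3 * (s / 3) ^ (-(1 / 2) : ℝ)) *
          (eLpNorm (fun z => fderiv ℝ (UnboundedOperators.heatKernel (E := E) (s / 3)) z w) q volume *
            eLpNorm φ p volume)) := hb₃.trans (mul_le_mul_right (hb₂.trans (mul_le_mul_right hb₁ _)) _)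
    _ ≤ _ := by
        rw [← mul_assoc]
        exact mul_le_mul_left hconst _

/-- **Young bound for `D³` in dimension three**: `‖∂ᵤ∂ᵥ∂_w e^{sΔ} φ‖_{Lᵖ} ≤ 216 s^{-3/2} ‖φ‖_{Lᵖ}`
(three Young bounds `3 (s/3)^{-1/2} ≤ 6 s^{-1/2}`). [folklore] -/
theorem eLpNorm_heatD3_le_dim3 (hE : Module.finrank ℝ E = 3) (hφ : MemLp φ p volume) (hp : 1 ≤ p)
    {s : ℝ} (hs : 0 < s) {u v w : E} (hu : ‖u‖ ≤ 1) (hv : ‖v‖ ≤ 1) (hw : ‖w‖ ≤ 1) :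
    eLpNorm (heatD3 s u v w φ) p volume ≤ ENNReal.ofReal (216 * s ^ (-(3 / 2) : ℝ)) * eLpNorm φ p volume := by
  have h3 : 0 < s / 3 := by positivity
  have hs3 : s / 3 + s / 3 + s / 3 = s := by ring
  have hK : ENNReal.ofReal (3 * (s / 3) ^ (-(1 / 2) : ℝ)) ≤ ENNReal.ofReal (6 * s ^ (-(1 / 2) : ℝ)) := by
    refine ENNReal.ofReal_le_ofReal ?_
    rw [div_three_rpow_neg hs, ← mul_assoc]
    refine mul_le_mul_of_nonneg_right ?_ (Real.rpow_nonneg hs.le _)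
    linarith [three_rpow_bounds.1]
  have hψ₁ : MemLp (heatD1 (s / 3) w φ) p volume := memLp_heatD1 hφ hp h3 w
  have hψ₂ : MemLp (heatD1 (s / 3) v (heatD1 (s / 3) w φ)) p volume := memLp_heatD1 hψ₁ hp h3 v
  have hD3 : heatD3 s u v w φ = heatD1 (s / 3) u (heatD1 (s / 3) v (heatD1 (s / 3) w φ)) := by
    have := heatD3_eq_heatD1_heatD1_heatD1 hφ hp h3 h3 h3 u v w
    rwa [hs3] at this
  rw [hD3]
  have e1 := (eLpNorm_heatD1_le_dim3 hE hφ hp h3 hw).trans (mul_le_mul_left hK _)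
  have e2 := (eLpNorm_heatD1_le_dim3 hE hψ₁ hp h3 hv).trans (mul_le_mul_left hK _)
  have e3 := (eLpNorm_heatD1_le_dim3 hE hψ₂ hp h3 hu).trans (mul_le_mul_left hK _)
  have hpow : 6 * s ^ (-(1 / 2) : ℝ) * (6 * s ^ (-(1 / 2) : ℝ)) * (6 * s ^ (-(1 / 2) : ℝ)) =
      216 * s ^ (-(3 / 2) : ℝ) := by
    have : s ^ (-(1 / 2) : ℝ) * s ^ (-(1 / 2) : ℝ) * s ^ (-(1 / 2) : ℝ) = s ^ (-(3 / 2) : ℝ) := by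
      rw [← Real.rpow_add hs, ← Real.rpow_add hs]; norm_num
    calc 6 * s ^ (-(1 / 2) : ℝ) * (6 * s ^ (-(1 / 2) : ℝ)) * (6 * s ^ (-(1 / 2) : ℝ))
        = 216 * (s ^ (-(1 / 2) : ℝ) * s ^ (-(1 / 2) : ℝ) * s ^ (-(1 / 2) : ℝ)) := by ring
      _ = 216 * s ^ (-(3 / 2) : ℝ) := by rw [this]
  calc eLpNorm (heatD1 (s / 3) u (heatD1 (s / 3) v (heatD1 (s / 3) w φ))) p volume
      ≤ ENNReal.ofReal (6 * s ^ (-(1 / 2) : ℝ)) * (ENNReal.ofReal (6 * s ^ (-(1 / 2) : ℝ)) *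
          (ENNReal.ofReal (6 * s ^ (-(1 / 2) : ℝ)) * eLpNorm φ p volume)) :=
        e3.trans (mul_le_mul_right (e2.trans (mul_le_mul_right e1 _)) _)
    _ = ENNReal.ofReal (216 * s ^ (-(3 / 2) : ℝ)) * eLpNorm φ p volume := by
        rw [← mul_assoc, ← mul_assoc, ← ENNReal.ofReal_mul (by positivity),
          ← ENNReal.ofReal_mul (by positivity), hpow]

end DerivBoundsDim3

/-! ## Joint continuity in `(s, x)` of the iterated derivatives -/

section IteratedContinuity

variable {E : Type*} [NormedAddCommGroup E] [InnerProductSpace ℝ E] [FiniteDimensional ℝ E]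
  [MeasurableSpace E] [BorelSpace E]
variable {F : Type*} [NormedAddCommGroup F] [NormedSpace ℝ F] [CompleteSpace F]

omit [CompleteSpace F] in
/-- **Inductive step**: convolving a jointly continuous, locally uniformly bounded family
`Ψ s` with the integrable kernel `∂ᵥ G_a` gives a jointly continuous family
`(s, x) ↦ ∫ ∂ᵥ G_a(y) Ψ s (x - y) dy` (dominated convergence). [folklore] -/
theorem continuousOn_integral_fderiv_heatKernel_smul_param {S : Set ℝ} (hS : IsOpen S)
    {Ψ : ℝ → E → F} (hΨc : ContinuousOn (Function.uncurry Ψ) (S ×ˢ univ))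
    (hΨb : ∀ s₀ ∈ S, ∃ M : ℝ, ∃ U ∈ 𝓝 s₀, ∀ s ∈ U, ∀ z, ‖Ψ s z‖ ≤ M)
    {a : ℝ} (ha : 0 < a) (v : E) :
    ContinuousOn (fun q : ℝ × E => ∫ y, fderiv ℝ (UnboundedOperators.heatKernel a) y v • Ψ q.1 (q.2 - y))
      (S ×ˢ univ) := by
  rintro ⟨s₀, x₀⟩ ⟨hs₀, -⟩
  refine ContinuousAt.continuousWithinAt ?_
  obtain ⟨M, U, hU, hM⟩ := hΨb s₀ hs₀
  have hUS : U ∩ S ∈ 𝓝 s₀ := inter_mem hU (hS.mem_nhds hs₀)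
  have hslice : ∀ s ∈ S, Continuous (Ψ s) := fun s hs =>
    (hΨc.comp_continuous (Continuous.prodMk_right s) fun z => ⟨hs, mem_univ _⟩ :)
  refine continuousAt_of_dominated (bound := fun y => ‖fderiv ℝ (UnboundedOperators.heatKernel a) y v‖ * M) ?_ ?_ ?_ ?_
  · filter_upwards [prod_mem_nhds hUS univ_mem] with q hq
    exact (UnboundedOperators.continuous_fderiv_heatKernel_apply a v).aestronglyMeasurable.smul
      ((hslice q.1 hq.1.2).comp (continuous_const.sub continuous_id)).aestronglyMeasurable
  · filter_upwards [prod_mem_nhds hUS univ_mem] with q hq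
    refine Eventually.of_forall fun y => ?_
    rw [norm_smul]
    exact mul_le_mul_of_nonneg_left (hM q.1 hq.1.1 _) (norm_nonneg _)
  · exact (UnboundedOperators.integrable_fderiv_heatKernel_apply ha v).norm.mul_const M
  · refine Eventually.of_forall fun y => ?_
    have h1 : ContinuousAt (fun q : ℝ × E => (q.1, q.2 - y)) (s₀, x₀) :=
      continuousAt_fst.prodMk (continuousAt_snd.sub continuousAt_const)
    have h2 : ContinuousAt (Function.uncurry Ψ) (s₀, x₀ - y) :=
      hΨc.continuousAt ((hS.prod isOpen_univ).mem_nhds ⟨hs₀, mem_univ _⟩)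
    exact continuousAt_const.smul (ContinuousAt.comp_of_eq h2 h1 rfl)

/-- The same, identified with `heatD1 a v (Ψ s)` when the slices are in `Lᵖ`. [folklore] -/
theorem continuousOn_heatD1_param {S : Set ℝ} (hS : IsOpen S) {Ψ : ℝ → E → ℝ}
    (hΨc : ContinuousOn (Function.uncurry Ψ) (S ×ˢ univ))
    (hΨb : ∀ s₀ ∈ S, ∃ M : ℝ, ∃ U ∈ 𝓝 s₀, ∀ s ∈ U, ∀ z, ‖Ψ s z‖ ≤ M)
    {p : ℝ≥0∞} (hΨp : ∀ s ∈ S, MemLp (Ψ s) p volume) (hp : 1 ≤ p) {a : ℝ} (ha : 0 < a) (v : E) :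
    ContinuousOn (fun q : ℝ × E => heatD1 a v (Ψ q.1) q.2) (S ×ˢ univ) := by
  refine (continuousOn_integral_fderiv_heatKernel_smul_param hS hΨc hΨb ha v).congr fun q hq => ?_
  rw [heatD1, UnboundedOperators.fderiv_heatExtension_apply_eq_convolution (hΨp q.1 hq.1) hp ha, convolution_def]
  rfl

/-- A uniform `L^∞` bound for `heatD1 d w φ`, `φ ∈ L¹`, `d ≥ d₀ > 0`:
`|∂_w e^{dΔ} φ (z)| ≤ (4π d₀)^{-n/2} d₀^{-1/2} ‖w‖ ‖φ‖₁`. [folklore] -/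
theorem norm_heatD1_le_of_le {φ : E → ℝ} (hφ : MemLp φ 1 volume) {d₀ d : ℝ} (hd₀ : 0 < d₀)
    (hd : d₀ ≤ d) (w z : E) :
    ‖heatD1 d w φ z‖ ≤ (4 * π * d₀) ^ (-(Module.finrank ℝ E : ℝ) / 2) * (Real.sqrt d₀)⁻¹ * ‖w‖ *
      (eLpNorm φ 1 volume).toReal := by
  have hdpos : 0 < d := lt_of_lt_of_le hd₀ hd
  have h1 := enorm_heatD1_le hφ le_rfl hdpos w z ∞
  have h2 := UnboundedOperators.eLpNorm_top_fderiv_heatKernel_apply_le hdpos w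
  have h3 : (4 * π * d) ^ (-(Module.finrank ℝ E : ℝ) / 2) * (Real.sqrt d)⁻¹ * ‖w‖ ≤
      (4 * π * d₀) ^ (-(Module.finrank ℝ E : ℝ) / 2) * (Real.sqrt d₀)⁻¹ * ‖w‖ := by
    refine mul_le_mul_of_nonneg_right (mul_le_mul ?_ ?_ (by positivity) (by positivity))
      (norm_nonneg _)
    · exact Real.rpow_le_rpow_of_nonpos (by positivity) (by nlinarith [Real.pi_pos])
        (by rw [neg_div]; exact neg_nonpos.2 (by positivity))
    · exact inv_anti₀ (Real.sqrt_pos.2 hd₀) (Real.sqrt_le_sqrt hd)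
  have hfin : eLpNorm φ 1 volume ≠ ∞ := hφ.eLpNorm_ne_top
  set c₀ : ℝ := (4 * π * d₀) ^ (-(Module.finrank ℝ E : ℝ) / 2) * (Real.sqrt d₀)⁻¹ * ‖w‖ with hc₀
  have hc₀0 : 0 ≤ c₀ := by rw [hc₀]; positivity
  have h4 : ‖heatD1 d w φ z‖ₑ ≤ ENNReal.ofReal c₀ * eLpNorm φ 1 volume :=
    h1.trans (mul_le_mul_left (h2.trans (ENNReal.ofReal_le_ofReal h3)) _)
  calc ‖heatD1 d w φ z‖ = ‖heatD1 d w φ z‖ₑ.toReal := (toReal_enorm _).symm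
    _ ≤ (ENNReal.ofReal c₀ * eLpNorm φ 1 volume).toReal :=
        ENNReal.toReal_mono (ENNReal.mul_ne_top ENNReal.ofReal_ne_top hfin) h4
    _ = c₀ * (eLpNorm φ 1 volume).toReal := by
        rw [ENNReal.toReal_mul, ENNReal.toReal_ofReal hc₀0]

/-- Sup bound for `heatD1 a v ψ` of a bounded `Lᵖ` function: `|∂ᵥ e^{aΔ} ψ| ≤ ‖∂ᵥ G_a‖₁ sup|ψ|`.
[folklore] -/
theorem norm_heatD1_le_of_bound {ψ : E → ℝ} {p : ℝ≥0∞} (hψ : MemLp ψ p volume) (hp : 1 ≤ p)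
    {M : ℝ} (hM : ∀ z, ‖ψ z‖ ≤ M) {a : ℝ} (ha : 0 < a) (v z : E) :
    ‖heatD1 a v ψ z‖ ≤ (2 : ℝ) ^ ((Module.finrank ℝ E : ℝ) / 2) * a ^ (-(1 / 2) : ℝ) * ‖v‖ * M := by
  have hM0 : 0 ≤ M := (norm_nonneg _).trans (hM z)
  rw [heatD1, UnboundedOperators.fderiv_heatExtension_apply_eq_convolution hψ hp ha, convolution_def]
  have hint : Integrable (fun y => ‖fderiv ℝ (UnboundedOperators.heatKernel a) y v‖ * M) :=
    (UnboundedOperators.integrable_fderiv_heatKernel_apply ha v).norm.mul_const M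
  refine (norm_integral_le_of_norm_le hint (Eventually.of_forall fun y => ?_)).trans ?_
  · simp only [ContinuousLinearMap.lsmul_apply, norm_smul]
    exact mul_le_mul_of_nonneg_left (hM _) (norm_nonneg _)
  · rw [integral_mul_const]
    refine mul_le_mul_of_nonneg_right ?_ hM0
    rw [integral_norm_eq_lintegral_enorm (UnboundedOperators.continuous_fderiv_heatKernel_apply a v).aestronglyMeasurable]
    have h := UnboundedOperators.lintegral_enorm_fderiv_heatKernel_apply_le ha v (E := E)
    calc (∫⁻ y, ‖fderiv ℝ (UnboundedOperators.heatKernel a) y v‖ₑ).toReal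
        ≤ (ENNReal.ofReal ((2 : ℝ) ^ ((Module.finrank ℝ E : ℝ) / 2) * a ^ (-(1 / 2) : ℝ) * ‖v‖)).toReal :=
          ENNReal.toReal_mono ENNReal.ofReal_ne_top h
      _ = _ := ENNReal.toReal_ofReal (by positivity)

variable {φ : E → ℝ}

/-- **Joint continuity of `(s, x) ↦ ∂ᵤ∂ᵥ∂_w e^{sΔ} φ (x)` on `(0, ∞) × E`** for `φ ∈ L¹` (three
applications of the inductive step on `(2a, ∞)`, `a = s₀/4`). [folklore] -/
theorem continuousOn_uncurry_heatD3 (hφ : MemLp φ 1 volume) (u v w : E) :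
    ContinuousOn (fun q : ℝ × E => heatD3 q.1 u v w φ q.2) (Ioi 0 ×ˢ univ) := by
  rintro ⟨s₀, x₀⟩ ⟨hs₀', -⟩
  have hs₀ : 0 < s₀ := hs₀'
  set a : ℝ := s₀ / 4 with ha_def
  have ha : 0 < a := by positivity
  set S : Set ℝ := Ioi (2 * a) with hS_def
  have hSo : IsOpen S := isOpen_Ioi
  have hs₀S : s₀ ∈ S := by rw [hS_def, mem_Ioi, ha_def]; linarith
  -- level 1
  set Ψ₁ : ℝ → E → ℝ := fun s => heatD1 (s - 2 * a) w φ with hΨ₁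
  have hΨ₁p : ∀ s ∈ S, MemLp (Ψ₁ s) 1 volume := fun s hs =>
    memLp_heatD1 hφ le_rfl (by rw [hS_def, mem_Ioi] at hs; linarith) w
  have hΨ₁c : ContinuousOn (Function.uncurry Ψ₁) (S ×ˢ univ) := by
    have h := UnboundedOperators.continuousOn_uncurry_fderiv_heatExtension_of_memLp hφ le_rfl w
    refine (h.comp (f := fun q : ℝ × E => (q.1 - 2 * a, q.2))
      ((continuous_fst.sub continuous_const).prodMk continuous_snd).continuousOn
      fun q hq => ⟨?_, mem_univ _⟩).congr fun q hq => rfl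
    have : 2 * a < q.1 := hq.1
    exact mem_Ioi.2 (by linarith)
  have hΨ₁b : ∀ s₁ ∈ S, ∃ M : ℝ, ∃ U ∈ 𝓝 s₁, ∀ s ∈ U, ∀ z, ‖Ψ₁ s z‖ ≤ M := by
    intro s₁ hs₁
    have hs₁' : 2 * a < s₁ := hs₁
    set d₀ : ℝ := (s₁ - 2 * a) / 2 with hd₀
    have hd₀0 : 0 < d₀ := by rw [hd₀]; linarith
    refine ⟨(4 * π * d₀) ^ (-(Module.finrank ℝ E : ℝ) / 2) * (Real.sqrt d₀)⁻¹ * ‖w‖ *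
      (eLpNorm φ 1 volume).toReal, Ioi (2 * a + d₀), isOpen_Ioi.mem_nhds ?_, fun s hs z => ?_⟩
    · rw [mem_Ioi, hd₀]; linarith
    · rw [mem_Ioi] at hs
      exact norm_heatD1_le_of_le hφ hd₀0 (by linarith) w z
  -- level 2
  set Ψ₂ : ℝ → E → ℝ := fun s => heatD1 a v (Ψ₁ s) with hΨ₂
  have hΨ₂c : ContinuousOn (Function.uncurry Ψ₂) (S ×ˢ univ) :=
    continuousOn_heatD1_param hSo hΨ₁c hΨ₁b hΨ₁p le_rfl ha v
  have hΨ₂p : ∀ s ∈ S, MemLp (Ψ₂ s) 1 volume := fun s hs => memLp_heatD1 (hΨ₁p s hs) le_rfl ha v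
  have hΨ₂b : ∀ s₁ ∈ S, ∃ M : ℝ, ∃ U ∈ 𝓝 s₁, ∀ s ∈ U, ∀ z, ‖Ψ₂ s z‖ ≤ M := by
    intro s₁ hs₁
    obtain ⟨M, U, hU, hM⟩ := hΨ₁b s₁ hs₁
    refine ⟨(2 : ℝ) ^ ((Module.finrank ℝ E : ℝ) / 2) * a ^ (-(1 / 2) : ℝ) * ‖v‖ * M, U ∩ S,
      inter_mem hU (hSo.mem_nhds hs₁), fun s hs z => ?_⟩
    exact norm_heatD1_le_of_bound (hΨ₁p s hs.2) le_rfl (hM s hs.1) ha v z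
  -- level 3
  have h3 : ContinuousOn (fun q : ℝ × E => heatD1 a u (Ψ₂ q.1) q.2) (S ×ˢ univ) :=
    continuousOn_heatD1_param hSo hΨ₂c hΨ₂b hΨ₂p le_rfl ha u
  have hrepr : ∀ q ∈ S ×ˢ (univ : Set E), heatD3 q.1 u v w φ q.2 = heatD1 a u (Ψ₂ q.1) q.2 := by
    rintro ⟨s, x⟩ ⟨hs, -⟩
    have hs' : 2 * a < s := hs
    have hd : 0 < s - 2 * a := by linarith
    have := heatD3_eq_heatD1_heatD1_heatD1 hφ le_rfl ha ha hd u v w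
    rw [show a + a + (s - 2 * a) = s by ring] at this
    rw [this]
  have h4 : ContinuousOn (fun q : ℝ × E => heatD3 q.1 u v w φ q.2) (S ×ˢ univ) :=
    h3.congr hrepr
  exact (h4.continuousAt ((hSo.prod isOpen_univ).mem_nhds ⟨hs₀S, mem_univ _⟩)).continuousWithinAt

/-- For fixed `τ > 0`, `(σ, x) ↦ ∂ᵤ∂ᵥ∂_w e^{(τ+σ)Δ} φ (x)` is a.e. strongly measurable on
`(0, ∞) × E` (it is continuous there). [folklore] -/
theorem aestronglyMeasurable_heatD3_add (hφ : MemLp φ 1 volume) {τ : ℝ} (hτ : 0 < τ) (u v w : E) :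
    AEStronglyMeasurable (fun q : ℝ × E => heatD3 (τ + q.1) u v w φ q.2)
      ((volume.restrict (Ioi (0 : ℝ))).prod (volume : Measure E)) := by
  have hc : ContinuousOn (fun q : ℝ × E => heatD3 (τ + q.1) u v w φ q.2) (Ioi 0 ×ˢ univ) := by
    refine (continuousOn_uncurry_heatD3 hφ u v w).comp (f := fun q : ℝ × E => (τ + q.1, q.2))
      ((continuous_const.add continuous_fst).prodMk continuous_snd).continuousOn fun q hq => ?_
    exact ⟨mem_Ioi.2 (by have : (0 : ℝ) < q.1 := hq.1; linarith), mem_univ _⟩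
  have hmeas : MeasurableSet (Ioi (0 : ℝ) ×ˢ (univ : Set E)) := measurableSet_Ioi.prod MeasurableSet.univ
  have h := hc.aestronglyMeasurable (μ := (volume : Measure ℝ).prod (volume : Measure E)) hmeas
  rw [← Measure.prod_restrict, Measure.restrict_univ] at h
  exact h

end IteratedContinuity

/-! ## The Oseen–heat operator `e^{τΔ} P ∇·` without Fourier analysis -/

section Oseen

variable {E : Type*} [NormedAddCommGroup E] [InnerProductSpace ℝ E] [FiniteDimensional ℝ E]
  [MeasurableSpace E] [BorelSpace E]

/-- **The Oseen–heat operator** `𝒩_τ F = e^{τΔ} P ∇·F` acting on a matrix field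
`F = (Fⱼₖ)` of scalar functions, realised without Fourier analysis or singular integrals:
`(𝒩_τ F)ᵢ = ∑ⱼ ∂ⱼ e^{τΔ} Fⱼᵢ + ∑ⱼₖ ∫₀^∞ ∂ᵢ∂ⱼ∂ₖ e^{(τ+σ)Δ} Fⱼₖ dσ`
(the Leray correction `-∇Δ⁻¹ div ∇·F` through `-Δ⁻¹ = ∫₀^∞ e^{σΔ} dσ`). For `F = u ⊗ u` this is
the Duhamel integrand `e^{τΔ} P ∇·(u ⊗ u)` of the Navier–Stokes equations (Tao 2011, (45);
Lemarié-Rieusset 2002, Ch. 11, the Oseen kernel). The `σ`-integral is a Bochner integral over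
`(0, ∞)` (absolutely convergent for `Fⱼₖ ∈ L¹ ∪ L² ∪ L^∞` and `τ > 0`). [folklore] -/
def oseenHeat (τ : ℝ) (F : Fin (Module.finrank ℝ E) → Fin (Module.finrank ℝ E) → E → ℝ)
    (i : Fin (Module.finrank ℝ E)) (x : E) : ℝ :=
  (∑ j, heatD1 τ (stdOrthonormalBasis ℝ E j) (F j i) x) +
    ∑ j, ∑ k, ∫ σ in Ioi (0 : ℝ), heatD3 (τ + σ) (stdOrthonormalBasis ℝ E i)
      (stdOrthonormalBasis ℝ E j) (stdOrthonormalBasis ℝ E k) (F j k) x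

/-- `‖∑ aᵢ‖ₑ ≤ ∑ ‖aᵢ‖ₑ`. [folklore] -/
theorem enorm_sum_le' {ι : Type*} (s : Finset ι) {G : Type*} [SeminormedAddCommGroup G]
    (a : ι → G) : ‖∑ i ∈ s, a i‖ₑ ≤ ∑ i ∈ s, ‖a i‖ₑ := by
  rw [← ofReal_norm]
  refine (ENNReal.ofReal_le_ofReal (norm_sum_le _ _)).trans (le_of_eq ?_)
  rw [ENNReal.ofReal_sum_of_nonneg fun i _ => norm_nonneg _]
  exact Finset.sum_congr rfl fun i _ => ofReal_norm _

/-- `∫⁻_{(0,∞)} f(τ + σ) dσ = ∫⁻_{(τ,∞)} f`. [folklore] -/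
theorem lintegral_Ioi_comp_const_add (f : ℝ → ℝ≥0∞) (τ : ℝ) :
    ∫⁻ σ in Ioi 0, f (τ + σ) = ∫⁻ s in Ioi τ, f s := by
  rw [← UnboundedOperators.lintegral_Ioi_comp_sub (fun t => f (τ + t)) τ]
  refine setLIntegral_congr_fun measurableSet_Ioi fun s _ => ?_
  rw [add_sub_cancel]

/-- The tail integral `∫₀^∞ C (τ + σ)^{-e} dσ = C τ^{1-e}/(e - 1)` (`e > 1`), `ℝ≥0∞` form. [folklore] -/
theorem lintegral_Ioi_ofReal_mul_rpow_add {C e τ : ℝ} (hC : 0 ≤ C) (he : 1 < e) (hτ : 0 < τ) :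
    ∫⁻ σ in Ioi 0, ENNReal.ofReal (C * (τ + σ) ^ (-e)) =
      ENNReal.ofReal (C * (τ ^ (1 - e) / (e - 1))) := by
  rw [lintegral_Ioi_comp_const_add (fun s => ENNReal.ofReal (C * s ^ (-e))) τ]
  have : ∀ s ∈ Ioi τ, ENNReal.ofReal (C * s ^ (-e)) = ENNReal.ofReal C * ENNReal.ofReal (s ^ (-e)) :=
    fun s _ => ENNReal.ofReal_mul hC
  rw [setLIntegral_congr_fun measurableSet_Ioi this, lintegral_const_mul' _ _ ENNReal.ofReal_ne_top,
    UnboundedOperators.lintegral_Ioi_rpow (by linarith) hτ, ← ENNReal.ofReal_mul hC]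
  congr 2
  rw [show -e + 1 = 1 - e by ring]
  have h1 : (1 - e : ℝ) ≠ 0 := by linarith
  have h2 : (e - 1 : ℝ) ≠ 0 := by linarith
  field_simp
  ring

variable {φ : E → ℝ}

/-- **Tail bound for the Leray correction**: a pointwise decay `|∂³ e^{sΔ} φ (x)| ≤ C s^{-e} X`
with `e > 1` integrates to `|∫₀^∞ ∂³ e^{(τ+σ)Δ} φ (x) dσ| ≤ C τ^{1-e}/(e-1) · X`. [folklore] -/
theorem enorm_integral_Ioi_heatD3_le {u v w : E} {x : E} {C e : ℝ} {X : ℝ≥0∞} (hC : 0 ≤ C)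
    (he : 1 < e) (hbound : ∀ s : ℝ, 0 < s → ‖heatD3 s u v w φ x‖ₑ ≤ ENNReal.ofReal (C * s ^ (-e)) * X)
    {τ : ℝ} (hτ : 0 < τ) :
    ‖∫ σ in Ioi (0 : ℝ), heatD3 (τ + σ) u v w φ x‖ₑ ≤
      ENNReal.ofReal (C * (τ ^ (1 - e) / (e - 1))) * X := by
  refine (enorm_integral_le_lintegral_enorm _).trans ?_
  calc ∫⁻ σ in Ioi (0 : ℝ), ‖heatD3 (τ + σ) u v w φ x‖ₑ
      ≤ ∫⁻ σ in Ioi (0 : ℝ), ENNReal.ofReal (C * (τ + σ) ^ (-e)) * X :=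
        setLIntegral_mono' measurableSet_Ioi fun σ hσ => hbound _ (by
          have : (0 : ℝ) < σ := hσ; linarith)
    _ = ENNReal.ofReal (C * (τ ^ (1 - e) / (e - 1))) * X := by
        rw [lintegral_mul_const'' _ (by fun_prop), lintegral_Ioi_ofReal_mul_rpow_add hC he hτ]

omit [MeasurableSpace E] [BorelSpace E] in
/-- The frame vectors are unit vectors. [folklore] -/
theorem norm_stdOrthonormalBasis_le_one (i : Fin (Module.finrank ℝ E)) :
    ‖stdOrthonormalBasis ℝ E i‖ ≤ 1 :=
  ((stdOrthonormalBasis ℝ E).orthonormal.1 i).le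

variable (hE : Module.finrank ℝ E = 3)
include hE

/-- `D³` decay, `L¹` data: `|∂³ e^{sΔ} φ (x)| ≤ 243 s⁻³ ‖φ‖_{L¹}`. [folklore] -/
theorem enorm_heatD3_le_of_one (hφ : MemLp φ 1 volume) {s : ℝ} (hs : 0 < s)
    (i j k : Fin (Module.finrank ℝ E)) (x : E) :
    ‖heatD3 s (stdOrthonormalBasis ℝ E i) (stdOrthonormalBasis ℝ E j) (stdOrthonormalBasis ℝ E k) φ x‖ₑ
      ≤ ENNReal.ofReal (243 * s ^ (-(3 : ℝ))) * eLpNorm φ 1 volume := by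
  have h := enorm_heatD3_le_dim3 hE hφ le_rfl hs (norm_stdOrthonormalBasis_le_one i)
    (norm_stdOrthonormalBasis_le_one j) x ∞ (w := stdOrthonormalBasis ℝ E k)
  have hK := eLpNorm_top_fderiv_heatKernel_apply_le_dim3 hE (by positivity : 0 < s / 3)
    (norm_stdOrthonormalBasis_le_one k)
  refine h.trans ?_
  rw [← mul_assoc]
  refine mul_le_mul_left ((mul_le_mul_right hK _).trans ?_) _
  rw [← ENNReal.ofReal_mul (by positivity)]
  refine ENNReal.ofReal_le_ofReal (le_of_eq ?_)
  rw [div_three_rpow_neg hs, ← Real.rpow_neg_one s, show ((3 : ℝ) ^ (2 : ℝ)) = 9 by norm_num]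
  rw [mul_assoc, mul_left_comm (s ^ (-1 : ℝ)), ← Real.rpow_add hs]
  norm_num
  ring

/-- `D³` decay, `L²` data: `|∂³ e^{sΔ} φ (x)| ≤ 216 s^{-9/4} ‖φ‖_{L²}`. [folklore] -/
theorem enorm_heatD3_le_of_two (hφ : MemLp φ 2 volume) {s : ℝ} (hs : 0 < s)
    (i j k : Fin (Module.finrank ℝ E)) (x : E) :
    ‖heatD3 s (stdOrthonormalBasis ℝ E i) (stdOrthonormalBasis ℝ E j) (stdOrthonormalBasis ℝ E k) φ x‖ₑ
      ≤ ENNReal.ofReal (216 * s ^ (-(9 / 4 : ℝ))) * eLpNorm φ 2 volume := by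
  have h := enorm_heatD3_le_dim3 hE hφ one_le_two hs (norm_stdOrthonormalBasis_le_one i)
    (norm_stdOrthonormalBasis_le_one j) x 2 (w := stdOrthonormalBasis ℝ E k)
  have hK := eLpNorm_two_fderiv_heatKernel_apply_le_dim3 hE (by positivity : 0 < s / 3)
    (norm_stdOrthonormalBasis_le_one k)
  refine h.trans ?_
  rw [← mul_assoc]
  refine mul_le_mul_left ((mul_le_mul_right hK _).trans ?_) _
  rw [← ENNReal.ofReal_mul (by positivity)]
  refine ENNReal.ofReal_le_ofReal ?_
  rw [div_three_rpow_neg hs, ← Real.rpow_neg_one s]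
  have h4 := three_rpow_bounds.2
  have hs1 : 0 ≤ s ^ (-1 : ℝ) := Real.rpow_nonneg hs.le _
  have hs2 : 0 ≤ s ^ (-(5 / 4) : ℝ) := Real.rpow_nonneg hs.le _
  have heq : s ^ (-1 : ℝ) * s ^ (-(5 / 4) : ℝ) = s ^ (-(9 / 4) : ℝ) := by
    rw [← Real.rpow_add hs]; norm_num
  calc 27 * s ^ (-1 : ℝ) * (2 * ((3 : ℝ) ^ (5 / 4 : ℝ) * s ^ (-(5 / 4) : ℝ)))
      = 54 * (3 : ℝ) ^ (5 / 4 : ℝ) * (s ^ (-1 : ℝ) * s ^ (-(5 / 4) : ℝ)) := by ring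
    _ ≤ 54 * 4 * (s ^ (-1 : ℝ) * s ^ (-(5 / 4) : ℝ)) := by gcongr
    _ = 216 * s ^ (-(9 / 4 : ℝ)) := by rw [heq]; ring

/-- `D³` decay, bounded data: `|∂³ e^{sΔ} φ (x)| ≤ 162 s^{-3/2} ‖φ‖_{L^∞}`. [folklore] -/
theorem enorm_heatD3_le_of_top (hφ : MemLp φ ∞ volume) {s : ℝ} (hs : 0 < s)
    (i j k : Fin (Module.finrank ℝ E)) (x : E) :
    ‖heatD3 s (stdOrthonormalBasis ℝ E i) (stdOrthonormalBasis ℝ E j) (stdOrthonormalBasis ℝ E k) φ x‖ₑ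
      ≤ ENNReal.ofReal (162 * s ^ (-(3 / 2 : ℝ))) * eLpNorm φ ∞ volume := by
  have h := enorm_heatD3_le_dim3 hE hφ le_top hs (norm_stdOrthonormalBasis_le_one i)
    (norm_stdOrthonormalBasis_le_one j) x 1 (w := stdOrthonormalBasis ℝ E k)
  have hK := lintegral_enorm_fderiv_heatKernel_apply_le_dim3 hE (by positivity : 0 < s / 3)
    (norm_stdOrthonormalBasis_le_one k)
  rw [← eLpNorm_one_eq_lintegral_enorm] at hK
  refine h.trans ?_
  rw [← mul_assoc]
  refine mul_le_mul_left ((mul_le_mul_right hK _).trans ?_) _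
  rw [← ENNReal.ofReal_mul (by positivity)]
  refine ENNReal.ofReal_le_ofReal ?_
  rw [div_three_rpow_neg hs, ← Real.rpow_neg_one s]
  have h4 := three_rpow_bounds.1
  have hs1 : 0 ≤ s ^ (-1 : ℝ) := Real.rpow_nonneg hs.le _
  have hs2 : 0 ≤ s ^ (-(1 / 2) : ℝ) := Real.rpow_nonneg hs.le _
  have heq : s ^ (-1 : ℝ) * s ^ (-(1 / 2) : ℝ) = s ^ (-(3 / 2) : ℝ) := by
    rw [← Real.rpow_add hs]; norm_num
  calc 27 * s ^ (-1 : ℝ) * (3 * ((3 : ℝ) ^ (1 / 2 : ℝ) * s ^ (-(1 / 2) : ℝ)))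
      = 81 * (3 : ℝ) ^ (1 / 2 : ℝ) * (s ^ (-1 : ℝ) * s ^ (-(1 / 2) : ℝ)) := by ring
    _ ≤ 81 * 2 * (s ^ (-1 : ℝ) * s ^ (-(1 / 2) : ℝ)) := by gcongr
    _ = 162 * s ^ (-(3 / 2 : ℝ)) := by rw [heq]; ring

/-- `D¹` decay at the frame vectors in dimension three, the three cases
`(p, q, bound) = (1, ∞, τ⁻²), (2, 2, 2τ^{-5/4}), (∞, 1, 3τ^{-1/2})`. [folklore] -/
theorem enorm_heatD1_le_cases {τ : ℝ} (hτ : 0 < τ) (j : Fin (Module.finrank ℝ E)) (x : E) :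
    (∀ {φ : E → ℝ}, MemLp φ 1 volume → ‖heatD1 τ (stdOrthonormalBasis ℝ E j) φ x‖ₑ ≤
        ENNReal.ofReal (τ ^ (-2 : ℝ)) * eLpNorm φ 1 volume) ∧
    (∀ {φ : E → ℝ}, MemLp φ 2 volume → ‖heatD1 τ (stdOrthonormalBasis ℝ E j) φ x‖ₑ ≤
        ENNReal.ofReal (2 * τ ^ (-(5 / 4) : ℝ)) * eLpNorm φ 2 volume) ∧
    (∀ {φ : E → ℝ}, MemLp φ ∞ volume → ‖heatD1 τ (stdOrthonormalBasis ℝ E j) φ x‖ₑ ≤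
        ENNReal.ofReal (3 * τ ^ (-(1 / 2) : ℝ)) * eLpNorm φ ∞ volume) := by
  have hj := norm_stdOrthonormalBasis_le_one (E := E) j
  refine ⟨fun hφ => ?_, fun hφ => ?_, fun hφ => ?_⟩
  · exact (enorm_heatD1_le hφ le_rfl hτ _ x ∞).trans
      (mul_le_mul_left (eLpNorm_top_fderiv_heatKernel_apply_le_dim3 hE hτ hj) _)
  · exact (enorm_heatD1_le hφ one_le_two hτ _ x 2).trans
      (mul_le_mul_left (eLpNorm_two_fderiv_heatKernel_apply_le_dim3 hE hτ hj) _)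
  · refine (enorm_heatD1_le hφ le_top hτ _ x 1).trans (mul_le_mul_left ?_ _)
    rw [eLpNorm_one_eq_lintegral_enorm]
    exact lintegral_enorm_fderiv_heatKernel_apply_le_dim3 hE hτ hj

omit hE in
/-- **Assembly of the operator bounds**: if `|∂ⱼ e^{τΔ} Fⱼᵢ| ≤ c₁ τ^{-e} ‖Fⱼᵢ‖_p` and
`|∫₀^∞ ∂ᵢ∂ⱼ∂ₖ e^{(τ+σ)Δ} Fⱼₖ dσ| ≤ c₃ τ^{-e} ‖Fⱼₖ‖_p`, then
`|(𝒩_τ F)ᵢ (x)| ≤ (c₁ + c₃) τ^{-e} ∑ⱼₖ ‖Fⱼₖ‖_p`. [folklore] -/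
theorem enorm_oseenHeat_le_of_bounds {F : Fin (Module.finrank ℝ E) → Fin (Module.finrank ℝ E) → E → ℝ}
    {p : ℝ≥0∞} {τ c₁ c₃ e : ℝ} (hτ : 0 < τ) (hc₁ : 0 ≤ c₁) (hc₃ : 0 ≤ c₃) (i : Fin (Module.finrank ℝ E)) (x : E)
    (hD1 : ∀ j, ‖heatD1 τ (stdOrthonormalBasis ℝ E j) (F j i) x‖ₑ ≤
      ENNReal.ofReal (c₁ * τ ^ (-e)) * eLpNorm (F j i) p volume)
    (hD3 : ∀ j k, ‖∫ σ in Ioi (0 : ℝ), heatD3 (τ + σ) (stdOrthonormalBasis ℝ E i)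
      (stdOrthonormalBasis ℝ E j) (stdOrthonormalBasis ℝ E k) (F j k) x‖ₑ ≤
      ENNReal.ofReal (c₃ * τ ^ (-e)) * eLpNorm (F j k) p volume) :
    ‖oseenHeat τ F i x‖ₑ ≤
      ENNReal.ofReal ((c₁ + c₃) * τ ^ (-e)) * ∑ j, ∑ k, eLpNorm (F j k) p volume := by
  have hτe : 0 ≤ τ ^ (-e) := Real.rpow_nonneg hτ.le _
  unfold oseenHeat
  refine (enorm_add_le _ _).trans ?_
  have h1 : ‖∑ j, heatD1 τ (stdOrthonormalBasis ℝ E j) (F j i) x‖ₑ ≤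
      ENNReal.ofReal (c₁ * τ ^ (-e)) * ∑ j, ∑ k, eLpNorm (F j k) p volume := by
    refine (enorm_sum_le' _ _).trans ?_
    rw [Finset.mul_sum]
    refine Finset.sum_le_sum fun j _ => (hD1 j).trans (mul_le_mul_right ?_ _)
    exact Finset.single_le_sum (f := fun k => eLpNorm (F j k) p volume) (fun _ _ => bot_le)
      (Finset.mem_univ i)
  have h2 : ‖∑ j, ∑ k, ∫ σ in Ioi (0 : ℝ), heatD3 (τ + σ) (stdOrthonormalBasis ℝ E i)
      (stdOrthonormalBasis ℝ E j) (stdOrthonormalBasis ℝ E k) (F j k) x‖ₑ ≤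
      ENNReal.ofReal (c₃ * τ ^ (-e)) * ∑ j, ∑ k, eLpNorm (F j k) p volume := by
    refine (enorm_sum_le' _ _).trans ?_
    rw [Finset.mul_sum]
    refine Finset.sum_le_sum fun j _ => (enorm_sum_le' _ _).trans ?_
    rw [Finset.mul_sum]
    exact Finset.sum_le_sum fun k _ => hD3 j k
  calc _ ≤ ENNReal.ofReal (c₁ * τ ^ (-e)) * ∑ j, ∑ k, eLpNorm (F j k) p volume +
        ENNReal.ofReal (c₃ * τ ^ (-e)) * ∑ j, ∑ k, eLpNorm (F j k) p volume := add_le_add h1 h2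
    _ = _ := by
        rw [← add_mul, ← ENNReal.ofReal_add (by positivity) (by positivity), ← add_mul]

/-- **`L¹ → L^∞` bound**: `|(𝒩_τ F)ᵢ (x)| ≤ 123 τ⁻² ∑ⱼₖ ‖Fⱼₖ‖_{L¹}`. [folklore] -/
theorem enorm_oseenHeat_le_of_one {F : Fin (Module.finrank ℝ E) → Fin (Module.finrank ℝ E) → E → ℝ}
    (hF : ∀ j k, MemLp (F j k) 1 volume) {τ : ℝ} (hτ : 0 < τ) (i : Fin (Module.finrank ℝ E)) (x : E) :
    ‖oseenHeat τ F i x‖ₑ ≤ ENNReal.ofReal (123 * τ ^ (-(2 : ℝ))) * ∑ j, ∑ k, eLpNorm (F j k) 1 volume := by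
  have h := enorm_oseenHeat_le_of_bounds (p := 1) (F := F) hτ zero_le_one (by norm_num : (0:ℝ) ≤ 122)
    i x (e := 2) (fun j => by simpa using (enorm_heatD1_le_cases hE hτ j x).1 (hF j i)) (fun j k => ?_)
  · refine h.trans (mul_le_mul_left (ENNReal.ofReal_le_ofReal ?_) _)
    norm_num
  · refine (enorm_integral_Ioi_heatD3_le (by norm_num : (0:ℝ) ≤ 243) (by norm_num : (1:ℝ) < 3)
      (fun s hs => enorm_heatD3_le_of_one hE (hF j k) hs i j k x) hτ).trans ?_
    refine mul_le_mul_left (ENNReal.ofReal_le_ofReal ?_) _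
    rw [show (1 - 3 : ℝ) = -2 by norm_num]
    have : 0 ≤ τ ^ (-2 : ℝ) := Real.rpow_nonneg hτ.le _
    nlinarith

/-- **`L² → L^∞` bound**: `|(𝒩_τ F)ᵢ (x)| ≤ 175 τ^{-5/4} ∑ⱼₖ ‖Fⱼₖ‖_{L²}`. [folklore] -/
theorem enorm_oseenHeat_le_of_two {F : Fin (Module.finrank ℝ E) → Fin (Module.finrank ℝ E) → E → ℝ}
    (hF : ∀ j k, MemLp (F j k) 2 volume) {τ : ℝ} (hτ : 0 < τ) (i : Fin (Module.finrank ℝ E)) (x : E) :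
    ‖oseenHeat τ F i x‖ₑ ≤
      ENNReal.ofReal (175 * τ ^ (-(5 / 4 : ℝ))) * ∑ j, ∑ k, eLpNorm (F j k) 2 volume := by
  have h := enorm_oseenHeat_le_of_bounds (p := 2) (F := F) hτ zero_le_two (by norm_num : (0:ℝ) ≤ 173)
    i x (e := 5 / 4) (fun j => (enorm_heatD1_le_cases hE hτ j x).2.1 (hF j i)) (fun j k => ?_)
  · refine h.trans (mul_le_mul_left (ENNReal.ofReal_le_ofReal ?_) _)
    norm_num
  · refine (enorm_integral_Ioi_heatD3_le (by norm_num : (0:ℝ) ≤ 216) (by norm_num : (1:ℝ) < 9 / 4)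
      (fun s hs => enorm_heatD3_le_of_two hE (hF j k) hs i j k x) hτ).trans ?_
    refine mul_le_mul_left (ENNReal.ofReal_le_ofReal ?_) _
    rw [show (1 - 9 / 4 : ℝ) = -(5 / 4) by norm_num, show (9 / 4 - 1 : ℝ) = 5 / 4 by norm_num]
    have : 0 ≤ τ ^ (-(5 / 4) : ℝ) := Real.rpow_nonneg hτ.le _
    have heq : (216 : ℝ) * (τ ^ (-(5 / 4) : ℝ) / (5 / 4)) = 172.8 * τ ^ (-(5 / 4) : ℝ) := by ring
    rw [heq]
    nlinarith

/-- **`L^∞ → L^∞` bound**: `|(𝒩_τ F)ᵢ (x)| ≤ 327 τ^{-1/2} ∑ⱼₖ ‖Fⱼₖ‖_{L^∞}`. [folklore] -/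
theorem enorm_oseenHeat_le_of_top {F : Fin (Module.finrank ℝ E) → Fin (Module.finrank ℝ E) → E → ℝ}
    (hF : ∀ j k, MemLp (F j k) ∞ volume) {τ : ℝ} (hτ : 0 < τ) (i : Fin (Module.finrank ℝ E)) (x : E) :
    ‖oseenHeat τ F i x‖ₑ ≤
      ENNReal.ofReal (327 * τ ^ (-(1 / 2 : ℝ))) * ∑ j, ∑ k, eLpNorm (F j k) ∞ volume := by
  have h := enorm_oseenHeat_le_of_bounds (p := ∞) (F := F) hτ (by norm_num : (0:ℝ) ≤ 3)
    (by norm_num : (0:ℝ) ≤ 324)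
    i x (e := 1 / 2) (fun j => (enorm_heatD1_le_cases hE hτ j x).2.2 (hF j i)) (fun j k => ?_)
  · refine h.trans (mul_le_mul_left (ENNReal.ofReal_le_ofReal ?_) _)
    norm_num
  · refine (enorm_integral_Ioi_heatD3_le (by norm_num : (0:ℝ) ≤ 162) (by norm_num : (1:ℝ) < 3 / 2)
      (fun s hs => enorm_heatD3_le_of_top hE (hF j k) hs i j k x) hτ).trans ?_
    refine mul_le_mul_left (ENNReal.ofReal_le_ofReal ?_) _
    rw [show (1 - 3 / 2 : ℝ) = -(1 / 2) by norm_num, show (3 / 2 - 1 : ℝ) = 1 / 2 by norm_num]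
    have : 0 ≤ τ ^ (-(1 / 2) : ℝ) := Real.rpow_nonneg hτ.le _
    have heq : (162 : ℝ) * (τ ^ (-(1 / 2) : ℝ) / (1 / 2)) = 324 * τ ^ (-(1 / 2) : ℝ) := by ring
    rw [heq]

end Oseen

/-! ## `L¹ → L¹` bound for the Oseen–heat operator -/

section L1Bound

variable {E : Type*} [NormedAddCommGroup E] [InnerProductSpace ℝ E] [FiniteDimensional ℝ E]
  [MeasurableSpace E] [BorelSpace E]

variable (hE : Module.finrank ℝ E = 3)
include hE

/-- **`L¹` bound for the Leray correction** (Minkowski's integral inequality via Tonelli):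
`‖∫₀^∞ ∂³ e^{(τ+σ)Δ} φ dσ‖_{L¹} ≤ ∫₀^∞ 216 (τ+σ)^{-3/2} dσ ‖φ‖_{L¹} = 432 τ^{-1/2} ‖φ‖_{L¹}`.
[folklore] -/
theorem lintegral_enorm_integral_Ioi_heatD3_le {φ : E → ℝ} (hφ : MemLp φ 1 volume) {τ : ℝ}
    (hτ : 0 < τ) (i j k : Fin (Module.finrank ℝ E)) :
    ∫⁻ x, ‖∫ σ in Ioi (0:ℝ), heatD3 (τ + σ) (stdOrthonormalBasis ℝ E i)
        (stdOrthonormalBasis ℝ E j) (stdOrthonormalBasis ℝ E k) φ x‖ₑ ≤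
      ENNReal.ofReal (432 * τ ^ (-(1 / 2 : ℝ))) * eLpNorm φ 1 volume := by
  set b := stdOrthonormalBasis ℝ E
  have hmeas := ((aestronglyMeasurable_heatD3_add hφ hτ (b i) (b j) (b k)).prod_swap).aemeasurable.enorm
  calc ∫⁻ x, ‖∫ σ in Ioi (0:ℝ), heatD3 (τ + σ) (b i) (b j) (b k) φ x‖ₑ
      ≤ ∫⁻ x, ∫⁻ σ in Ioi (0:ℝ), ‖heatD3 (τ + σ) (b i) (b j) (b k) φ x‖ₑ :=
        lintegral_mono fun x => enorm_integral_le_lintegral_enorm _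
    _ = ∫⁻ σ in Ioi (0:ℝ), ∫⁻ x, ‖heatD3 (τ + σ) (b i) (b j) (b k) φ x‖ₑ :=
        lintegral_lintegral_swap hmeas
    _ ≤ ∫⁻ σ in Ioi (0:ℝ), ENNReal.ofReal (216 * (τ + σ) ^ (-(3 / 2 : ℝ))) * eLpNorm φ 1 volume := by
        refine setLIntegral_mono' measurableSet_Ioi fun σ hσ => ?_
        have hs : 0 < τ + σ := by have : (0:ℝ) < σ := hσ; linarith
        rw [← eLpNorm_one_eq_lintegral_enorm]
        exact eLpNorm_heatD3_le_dim3 hE hφ le_rfl hs (norm_stdOrthonormalBasis_le_one i)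
          (norm_stdOrthonormalBasis_le_one j) (norm_stdOrthonormalBasis_le_one k)
    _ = ENNReal.ofReal (432 * τ ^ (-(1 / 2 : ℝ))) * eLpNorm φ 1 volume := by
        rw [lintegral_mul_const'' _ (by fun_prop),
          lintegral_Ioi_ofReal_mul_rpow_add (by norm_num) (by norm_num : (1:ℝ) < 3 / 2) hτ]
        rw [show (1 - 3 / 2 : ℝ) = -(1 / 2) by norm_num, show (3 / 2 - 1 : ℝ) = 1 / 2 by norm_num]
        congr 2
        ring

/-- **`L¹ → L¹` bound for the Oseen–heat operator** (dimension three):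
`‖(𝒩_τ F)ᵢ‖_{L¹} ≤ 435 τ^{-1/2} ∑ⱼₖ ‖Fⱼₖ‖_{L¹}` — the gradient of the Oseen kernel is
integrable with norm `O(τ^{-1/2})`. Lemarié-Rieusset 2002, Ch. 11 (Oseen kernel estimates).
[folklore] -/
theorem lintegral_enorm_oseenHeat_le_of_one
    {F : Fin (Module.finrank ℝ E) → Fin (Module.finrank ℝ E) → E → ℝ}
    (hF : ∀ j k, MemLp (F j k) 1 volume) {τ : ℝ} (hτ : 0 < τ) (i : Fin (Module.finrank ℝ E)) :
    ∫⁻ x, ‖oseenHeat τ F i x‖ₑ ≤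
      ENNReal.ofReal (435 * τ ^ (-(1 / 2 : ℝ))) * ∑ j, ∑ k, eLpNorm (F j k) 1 volume := by
  set b := stdOrthonormalBasis ℝ E
  set S := ∑ j, ∑ k, eLpNorm (F j k) 1 volume with hS
  have hτe : 0 ≤ τ ^ (-(1 / 2 : ℝ)) := Real.rpow_nonneg hτ.le _
  -- pointwise splitting
  have h1 : ∀ x, ‖oseenHeat τ F i x‖ₑ ≤ (∑ j, ‖heatD1 τ (b j) (F j i) x‖ₑ) +
      ∑ j, ∑ k, ‖∫ σ in Ioi (0:ℝ), heatD3 (τ + σ) (b i) (b j) (b k) (F j k) x‖ₑ := fun x => by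
    unfold oseenHeat
    refine (enorm_add_le _ _).trans (add_le_add (enorm_sum_le _ _) ?_)
    exact (enorm_sum_le _ _).trans (Finset.sum_le_sum fun j _ => enorm_sum_le _ _)
  -- measurability of the pieces
  have hm1 : ∀ j, AEMeasurable (fun x => ‖heatD1 τ (b j) (F j i) x‖ₑ) volume := fun j =>
    (contDiff_heatD1 (hF j i) le_rfl hτ (b j) (n := 0)).continuous.measurable.enorm.aemeasurable
  have hm3 : ∀ j k, AEMeasurable (fun x => ‖∫ σ in Ioi (0:ℝ), heatD3 (τ + σ) (b i) (b j) (b k)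
      (F j k) x‖ₑ) volume := fun j k =>
    ((aestronglyMeasurable_heatD3_add (hF j k) hτ (b i) (b j) (b k)).prod_swap.integral_prod_right').aemeasurable.enorm
  -- the two bounds
  have hA : ∑ j, ∫⁻ x, ‖heatD1 τ (b j) (F j i) x‖ₑ ≤ ENNReal.ofReal (3 * τ ^ (-(1 / 2 : ℝ))) * S := by
    rw [hS, Finset.mul_sum]
    refine Finset.sum_le_sum fun j _ => ?_
    rw [← eLpNorm_one_eq_lintegral_enorm]
    refine (eLpNorm_heatD1_le_dim3 hE (hF j i) le_rfl hτ (norm_stdOrthonormalBasis_le_one j)).trans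
      (mul_le_mul_right ?_ _)
    exact Finset.single_le_sum (f := fun k => eLpNorm (F j k) 1 volume) (fun _ _ => bot_le)
      (Finset.mem_univ i)
  have hB : ∑ j, ∑ k, ∫⁻ x, ‖∫ σ in Ioi (0:ℝ), heatD3 (τ + σ) (b i) (b j) (b k) (F j k) x‖ₑ ≤
      ENNReal.ofReal (432 * τ ^ (-(1 / 2 : ℝ))) * S := by
    rw [hS, Finset.mul_sum]
    refine Finset.sum_le_sum fun j _ => ?_
    rw [Finset.mul_sum]
    exact Finset.sum_le_sum fun k _ => lintegral_enorm_integral_Ioi_heatD3_le hE (hF j k) hτ i j k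
  calc ∫⁻ x, ‖oseenHeat τ F i x‖ₑ
      ≤ ∫⁻ x, ((∑ j, ‖heatD1 τ (b j) (F j i) x‖ₑ) +
          ∑ j, ∑ k, ‖∫ σ in Ioi (0:ℝ), heatD3 (τ + σ) (b i) (b j) (b k) (F j k) x‖ₑ) :=
        lintegral_mono h1
    _ = (∑ j, ∫⁻ x, ‖heatD1 τ (b j) (F j i) x‖ₑ) +
          ∑ j, ∑ k, ∫⁻ x, ‖∫ σ in Ioi (0:ℝ), heatD3 (τ + σ) (b i) (b j) (b k) (F j k) x‖ₑ := by
        rw [lintegral_add_left' (Finset.aemeasurable_fun_sum _ fun j _ => hm1 j),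
          lintegral_finsetSum' _ fun j _ => hm1 j,
          lintegral_finsetSum' _ fun j _ => Finset.aemeasurable_fun_sum _ fun k _ => hm3 j k]
        congr 1
        exact Finset.sum_congr rfl fun j _ => lintegral_finsetSum' _ fun k _ => hm3 j k
    _ ≤ ENNReal.ofReal (3 * τ ^ (-(1 / 2 : ℝ))) * S + ENNReal.ofReal (432 * τ ^ (-(1 / 2 : ℝ))) * S :=
        add_le_add hA hB
    _ = ENNReal.ofReal (435 * τ ^ (-(1 / 2 : ℝ))) * S := by
        rw [← add_mul, ← ENNReal.ofReal_add (by positivity) (by positivity), ← add_mul]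
        norm_num

end L1Bound

/-! ## Measurability of heat-flow quantities with measurably varying data -/

section ParamMeasurability

variable {E : Type*} [NormedAddCommGroup E] [InnerProductSpace ℝ E] [FiniteDimensional ℝ E]
  [MeasurableSpace E] [BorelSpace E]
variable {P : Type*} [MeasurableSpace P] {μ : Measure P} [SFinite μ]

/-- `(t, z) ↦ ∂ᵥ G_t(z)` is jointly measurable. [folklore] -/
theorem measurable_fderiv_heatKernel_apply_uncurry (v : E) :
    Measurable (fun q : ℝ × E => fderiv ℝ (UnboundedOperators.heatKernel q.1) q.2 v) := by
  have : (fun q : ℝ × E => fderiv ℝ (UnboundedOperators.heatKernel q.1) q.2 v) =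
      fun q => -(UnboundedOperators.heatKernel q.1 q.2 / (2 * q.1)) * ⟪q.2, v⟫ :=
    funext fun q => UnboundedOperators.fderiv_heatKernel_apply_eq_mul_inner _ _ _
  rw [this]
  -- joint measurability of `(t, z) ↦ G_t(z)` (the tree's `BMOInv.measurable_heatKernel_uncurry`)
  have hK : Measurable (fun q : ℝ × E => UnboundedOperators.heatKernel q.1 q.2) := by
    unfold UnboundedOperators.heatKernel
    fun_prop
  exact ((hK.div (measurable_const.mul measurable_fst)).neg).mul
    (measurable_snd.inner measurable_const)

/-- The projection `((p, x), y) ↦ (p, y)` is quasi-measure-preserving. [folklore] -/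
theorem quasiMeasurePreserving_proj_param :
    Measure.QuasiMeasurePreserving (fun r : (P × E) × E => (r.1.1, r.2))
      ((μ.prod (volume : Measure E)).prod (volume : Measure E)) (μ.prod volume) := by
  have h1 := (measurePreserving_prodAssoc μ (volume : Measure E)
    (volume : Measure E)).quasiMeasurePreserving
  have h2 : Measure.QuasiMeasurePreserving (Prod.map id Prod.snd)
      (μ.prod ((volume : Measure E).prod (volume : Measure E))) (μ.prod volume) :=
    QuasiMeasurePreserving.prodMap (Measure.QuasiMeasurePreserving.id μ)
      Measure.quasiMeasurePreserving_snd
  exact h2.comp h1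

/-- **Parametric convolution-type integrals are jointly measurable**: if `k`, `L : P × E → ℝ`
are jointly (a.e. strongly) measurable then so is `(p, x) ↦ ∫ k(p, x - y) L(p, y) dy`.
[folklore] -/
theorem aestronglyMeasurable_integral_sub_mul_param {k L : P × E → ℝ}
    (hk : AEStronglyMeasurable k (μ.prod (volume : Measure E)))
    (hL : AEStronglyMeasurable L (μ.prod (volume : Measure E))) :
    AEStronglyMeasurable (fun q : P × E => ∫ y, k (q.1, q.2 - y) * L (q.1, y)) (μ.prod volume) := by
  have hsub : Measure.QuasiMeasurePreserving (fun r : (P × E) × E => (r.1.1, r.1.2 - r.2))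
      ((μ.prod (volume : Measure E)).prod (volume : Measure E)) (μ.prod volume) := by
    have h1 := (measurePreserving_prodAssoc μ (volume : Measure E)
      (volume : Measure E)).quasiMeasurePreserving
    have h2 : Measure.QuasiMeasurePreserving (Prod.map id fun z : E × E => z.1 - z.2)
        (μ.prod ((volume : Measure E).prod (volume : Measure E))) (μ.prod volume) :=
      QuasiMeasurePreserving.prodMap (Measure.QuasiMeasurePreserving.id μ)
        (quasiMeasurePreserving_sub_of_right_invariant volume volume)
    exact h2.comp h1
  have hF : AEStronglyMeasurable (fun r : (P × E) × E => k (r.1.1, r.1.2 - r.2) * L (r.1.1, r.2))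
      ((μ.prod (volume : Measure E)).prod (volume : Measure E)) :=
    (hk.comp_quasiMeasurePreserving hsub).mul
      (hL.comp_quasiMeasurePreserving quasiMeasurePreserving_proj_param)
  exact hF.integral_prod_right'

/-- **Joint measurability of `(p, x) ↦ ∂ᵥ e^{c(p)Δ} g_p (x)`** for measurably varying data
`g_p = g(p, ·)` (a.e. in `Lᵖ⁰`) and measurable positive times `c(p)`. [folklore] -/
theorem aestronglyMeasurable_heatD1_param {c : P → ℝ} (hc : Measurable c) {g : P × E → ℝ}
    (hg : AEStronglyMeasurable g (μ.prod (volume : Measure E))) {p₀ : ℝ≥0∞} (hp₀ : 1 ≤ p₀)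
    (hgp : ∀ᵐ p ∂μ, 0 < c p ∧ MemLp (fun y => g (p, y)) p₀ volume) (v : E) :
    AEStronglyMeasurable (fun q : P × E => heatD1 (c q.1) v (fun y => g (q.1, y)) q.2)
      (μ.prod volume) := by
  have hk : AEStronglyMeasurable (fun q : P × E => fderiv ℝ (UnboundedOperators.heatKernel (c q.1)) q.2 v)
      (μ.prod (volume : Measure E)) :=
    ((measurable_fderiv_heatKernel_apply_uncurry v).comp
      ((hc.comp measurable_fst).prodMk measurable_snd)).aestronglyMeasurable
  refine (aestronglyMeasurable_integral_sub_mul_param hk hg).congr ?_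
  have hae : ∀ᵐ q ∂(μ.prod (volume : Measure E)), 0 < c q.1 ∧ MemLp (fun y => g (q.1, y)) p₀ volume :=
    Measure.quasiMeasurePreserving_fst.ae hgp
  filter_upwards [hae] with q hq
  rw [heatD1_eq_convolution hq.2 hp₀ hq.1 v, convolution_lsmul_swap]
  rfl

/-- Joint measurability of `(p, x) ↦ ∂³ e^{c(p)Δ} g_p (x)` (three applications of
`aestronglyMeasurable_heatD1_param` through the time splitting). [folklore] -/
theorem aestronglyMeasurable_heatD3_param {c : P → ℝ} (hc : Measurable c) {g : P × E → ℝ}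
    (hg : AEStronglyMeasurable g (μ.prod (volume : Measure E))) {p₀ : ℝ≥0∞} (hp₀ : 1 ≤ p₀)
    (hgp : ∀ᵐ p ∂μ, 0 < c p ∧ MemLp (fun y => g (p, y)) p₀ volume) (u v w : E) :
    AEStronglyMeasurable (fun q : P × E => heatD3 (c q.1) u v w (fun y => g (q.1, y)) q.2)
      (μ.prod volume) := by
  have hc3 : Measurable fun p => c p / 3 := hc.div_const 3
  have hgp3 : ∀ᵐ p ∂μ, 0 < c p / 3 ∧ MemLp (fun y => g (p, y)) p₀ volume :=
    hgp.mono fun p hp => ⟨by linarith [hp.1], hp.2⟩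
  set g₁ : P × E → ℝ := fun q => heatD1 (c q.1 / 3) w (fun y => g (q.1, y)) q.2 with hg₁_def
  have hg₁ : AEStronglyMeasurable g₁ (μ.prod volume) :=
    aestronglyMeasurable_heatD1_param hc3 hg hp₀ hgp3 w
  have hg₁p : ∀ᵐ p ∂μ, 0 < c p / 3 ∧ MemLp (fun y => g₁ (p, y)) p₀ volume :=
    hgp3.mono fun p hp => ⟨hp.1, memLp_heatD1 hp.2 hp₀ hp.1 w⟩
  set g₂ : P × E → ℝ := fun q => heatD1 (c q.1 / 3) v (fun y => g₁ (q.1, y)) q.2 with hg₂_def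
  have hg₂ : AEStronglyMeasurable g₂ (μ.prod volume) :=
    aestronglyMeasurable_heatD1_param hc3 hg₁ hp₀ hg₁p v
  have hg₂p : ∀ᵐ p ∂μ, 0 < c p / 3 ∧ MemLp (fun y => g₂ (p, y)) p₀ volume :=
    hg₁p.mono fun p hp => ⟨hp.1, memLp_heatD1 hp.2 hp₀ hp.1 v⟩
  have hg₃ := aestronglyMeasurable_heatD1_param hc3 hg₂ hp₀ hg₂p u
  refine hg₃.congr ?_
  have hae : ∀ᵐ q ∂(μ.prod (volume : Measure E)), 0 < c q.1 ∧ MemLp (fun y => g (q.1, y)) p₀ volume :=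
    Measure.quasiMeasurePreserving_fst.ae hgp
  filter_upwards [hae] with q hq
  have h3 : 0 < c q.1 / 3 := by linarith [hq.1]
  have hs := heatD3_eq_heatD1_heatD1_heatD1 hq.2 hp₀ h3 h3 h3 u v w
  rw [show c q.1 / 3 + c q.1 / 3 + c q.1 / 3 = c q.1 by ring] at hs
  exact hs.symm ▸ rfl

/-- Joint measurability of the Leray-correction integral
`(p, x) ↦ ∫₀^∞ ∂³ e^{(c(p)+σ)Δ} g_p (x) dσ`. [folklore] -/
theorem aestronglyMeasurable_integral_Ioi_heatD3_param {c : P → ℝ} (hc : Measurable c)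
    {g : P × E → ℝ} (hg : AEStronglyMeasurable g (μ.prod (volume : Measure E))) {p₀ : ℝ≥0∞}
    (hp₀ : 1 ≤ p₀) (hgp : ∀ᵐ p ∂μ, 0 < c p ∧ MemLp (fun y => g (p, y)) p₀ volume) (u v w : E) :
    AEStronglyMeasurable (fun q : P × E =>
      ∫ σ in Ioi (0:ℝ), heatD3 (c q.1 + σ) u v w (fun y => g (q.1, y)) q.2) (μ.prod volume) := by
  set μ' : Measure (P × ℝ) := μ.prod (volume.restrict (Ioi (0:ℝ))) with hμ'
  have hc' : Measurable fun p' : P × ℝ => c p'.1 + p'.2 := (hc.comp measurable_fst).add measurable_snd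
  have hQ : Measure.QuasiMeasurePreserving (fun q' : (P × ℝ) × E => (q'.1.1, q'.2))
      (μ'.prod volume) (μ.prod volume) :=
    QuasiMeasurePreserving.prodMap
      (Measure.quasiMeasurePreserving_fst (μ := μ) (ν := volume.restrict (Ioi (0:ℝ))))
      (Measure.QuasiMeasurePreserving.id (volume : Measure E))
  have hg' : AEStronglyMeasurable (fun q' : (P × ℝ) × E => g (q'.1.1, q'.2)) (μ'.prod volume) :=
    hg.comp_quasiMeasurePreserving hQ
  have hgp' : ∀ᵐ p' ∂μ', 0 < c p'.1 + p'.2 ∧ MemLp (fun y => g (p'.1, y)) p₀ volume := by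
    have h1 : ∀ᵐ p' ∂μ', 0 < c p'.1 ∧ MemLp (fun y => g (p'.1, y)) p₀ volume :=
      Measure.quasiMeasurePreserving_fst.ae hgp
    have h2 : ∀ᵐ p' ∂μ', p'.2 ∈ Ioi (0:ℝ) :=
      Measure.quasiMeasurePreserving_snd.ae (ae_restrict_mem measurableSet_Ioi)
    filter_upwards [h1, h2] with p' h1 h2
    exact ⟨by have : (0:ℝ) < p'.2 := h2; linarith [h1.1], h1.2⟩
  have h3 := aestronglyMeasurable_heatD3_param (μ := μ') hc' hg' hp₀ hgp' u v w
  -- reassociate `((p, σ), x) ↔ ((p, x), σ)`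
  have e : MeasurePreserving (fun r : (P × E) × ℝ => ((r.1.1, r.2), r.1.2))
      ((μ.prod (volume : Measure E)).prod (volume.restrict (Ioi (0:ℝ)))) (μ'.prod volume) := by
    have h1 := measurePreserving_prodAssoc μ (volume : Measure E) (volume.restrict (Ioi (0:ℝ)))
    have h2 : MeasurePreserving (Prod.map id Prod.swap)
        (μ.prod ((volume : Measure E).prod (volume.restrict (Ioi (0:ℝ)))))
        (μ.prod ((volume.restrict (Ioi (0:ℝ))).prod (volume : Measure E))) :=
      (MeasurePreserving.id μ).prod Measure.measurePreserving_swap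
    have h3 := (measurePreserving_prodAssoc μ (volume.restrict (Ioi (0:ℝ)))
      (volume : Measure E)).symm MeasurableEquiv.prodAssoc
    have h4 := (h3.comp h2).comp h1
    have hfun : (fun r : (P × E) × ℝ => ((r.1.1, r.2), r.1.2)) =
        (⇑(MeasurableEquiv.prodAssoc (α := P) (β := ℝ) (γ := E)).symm ∘ Prod.map id Prod.swap) ∘
          ⇑(MeasurableEquiv.prodAssoc (α := P) (β := E) (γ := ℝ)) := by
      funext r
      rfl
    rw [hfun]
    exact h4
  exact (h3.comp_measurePreserving e).integral_prod_right'

/-- Joint measurability of `(p, x) ↦ ∂² e^{c(p)Δ} g_p (x)` (two applications of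
`aestronglyMeasurable_heatD1_param` through the time splitting). [folklore] -/
theorem aestronglyMeasurable_heatD2_param {c : P → ℝ} (hc : Measurable c) {g : P × E → ℝ}
    (hg : AEStronglyMeasurable g (μ.prod (volume : Measure E))) {p₀ : ℝ≥0∞} (hp₀ : 1 ≤ p₀)
    (hgp : ∀ᵐ p ∂μ, 0 < c p ∧ MemLp (fun y => g (p, y)) p₀ volume) (v w : E) :
    AEStronglyMeasurable (fun q : P × E => heatD2 (c q.1) v w (fun y => g (q.1, y)) q.2)
      (μ.prod volume) := by
  have hc2 : Measurable fun p => c p / 2 := hc.div_const 2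
  have hgp2 : ∀ᵐ p ∂μ, 0 < c p / 2 ∧ MemLp (fun y => g (p, y)) p₀ volume :=
    hgp.mono fun p hp => ⟨by linarith [hp.1], hp.2⟩
  set g₁ : P × E → ℝ := fun q => heatD1 (c q.1 / 2) w (fun y => g (q.1, y)) q.2 with hg₁_def
  have hg₁ : AEStronglyMeasurable g₁ (μ.prod volume) :=
    aestronglyMeasurable_heatD1_param hc2 hg hp₀ hgp2 w
  have hg₁p : ∀ᵐ p ∂μ, 0 < c p / 2 ∧ MemLp (fun y => g₁ (p, y)) p₀ volume :=
    hgp2.mono fun p hp => ⟨hp.1, memLp_heatD1 hp.2 hp₀ hp.1 w⟩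
  have hg₂ := aestronglyMeasurable_heatD1_param hc2 hg₁ hp₀ hg₁p v
  refine hg₂.congr ?_
  have hae : ∀ᵐ q ∂(μ.prod (volume : Measure E)), 0 < c q.1 ∧ MemLp (fun y => g (q.1, y)) p₀ volume :=
    Measure.quasiMeasurePreserving_fst.ae hgp
  filter_upwards [hae] with q hq
  have h2 : 0 < c q.1 / 2 := by linarith [hq.1]
  have hs := heatD2_eq_heatD1_heatD1 hq.2 hp₀ h2 h2 v w
  rw [show c q.1 / 2 + c q.1 / 2 = c q.1 by ring] at hs
  exact hs.symm ▸ rfl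

/-- The projection `((a, b), c) ↦ (a, c)` is quasi-measure-preserving for s-finite product
measures. [folklore] -/
theorem quasiMeasurePreserving_proj₁₃ {α β γ : Type*} [MeasurableSpace α] [MeasurableSpace β]
    [MeasurableSpace γ] (μa : Measure α) (μb : Measure β) (μc : Measure γ) [SFinite μa]
    [SFinite μb] [SFinite μc] :
    Measure.QuasiMeasurePreserving (fun r : (α × β) × γ => (r.1.1, r.2))
      ((μa.prod μb).prod μc) (μa.prod μc) := by
  have h1 := (measurePreserving_prodAssoc μa μb μc).quasiMeasurePreserving
  have h2 : Measure.QuasiMeasurePreserving (Prod.map id Prod.snd) (μa.prod (μb.prod μc))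
      (μa.prod μc) :=
    QuasiMeasurePreserving.prodMap (Measure.QuasiMeasurePreserving.id μa)
      Measure.quasiMeasurePreserving_snd
  exact h2.comp h1

/-- The projection `((a, b), c) ↦ (a, b)`... rather `((a, b), c) ↦ (b, c)` is
quasi-measure-preserving for s-finite product measures. [folklore] -/
theorem quasiMeasurePreserving_proj₂₃ {α β γ : Type*} [MeasurableSpace α] [MeasurableSpace β]
    [MeasurableSpace γ] (μa : Measure α) (μb : Measure β) (μc : Measure γ) [SFinite μa]
    [SFinite μb] [SFinite μc] :
    Measure.QuasiMeasurePreserving (fun r : (α × β) × γ => (r.1.2, r.2))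
      ((μa.prod μb).prod μc) (μb.prod μc) :=
  QuasiMeasurePreserving.prodMap Measure.quasiMeasurePreserving_snd
    (Measure.QuasiMeasurePreserving.id μc)

/-- **Joint measurability of the Oseen–heat operator with measurably varying data**:
`(p, x) ↦ (𝒩_{c(p)} G_p)ᵢ (x)`. [folklore] -/
theorem aestronglyMeasurable_oseenHeat_param {c : P → ℝ} (hc : Measurable c)
    {G : Fin (Module.finrank ℝ E) → Fin (Module.finrank ℝ E) → P × E → ℝ}
    (hG : ∀ j k, AEStronglyMeasurable (G j k) (μ.prod (volume : Measure E))) {p₀ : ℝ≥0∞}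
    (hp₀ : 1 ≤ p₀) (hGp : ∀ᵐ p ∂μ, 0 < c p ∧ ∀ j k, MemLp (fun y => G j k (p, y)) p₀ volume)
    (i : Fin (Module.finrank ℝ E)) :
    AEStronglyMeasurable (fun q : P × E =>
      oseenHeat (c q.1) (fun j k y => G j k (q.1, y)) i q.2) (μ.prod volume) := by
  have hjk : ∀ j k, ∀ᵐ p ∂μ, 0 < c p ∧ MemLp (fun y => G j k (p, y)) p₀ volume := fun j k =>
    hGp.mono fun p hp => ⟨hp.1, hp.2 j k⟩
  unfold oseenHeat
  refine AEStronglyMeasurable.add (Finset.aestronglyMeasurable_fun_sum _ fun j _ => ?_)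
    (Finset.aestronglyMeasurable_fun_sum _ fun j _ =>
      Finset.aestronglyMeasurable_fun_sum _ fun k _ => ?_)
  · exact aestronglyMeasurable_heatD1_param hc (hG j i) hp₀ (hjk j i) _
  · exact aestronglyMeasurable_integral_Ioi_heatD3_param hc (hG j k) hp₀ (hjk j k) _ _ _

end ParamMeasurability

end Literature.Analysis.FluidPDE
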